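import Literature.NumberTheory.GaloisCohomology.PoitouTateFiniteUnramifiedTransport
import Literature.NumberTheory.GaloisRepresentations.GlobalPFinitenessProofs
import Literature.NumberTheory.GaloisCohomology.PoitouTateSelmerCountProofs
import HarnessLib

/-!
# Poitou–Tate duality for finite modules, 4/7: finiteness of Selmer groups, finite duality of `Ш`-duals, new places, `Ш²` read-out roads, weak Leopoldt (re-homed proofs)

**Poitou–Tate duality for finite Galois modules over number fields and its consequences, proved in the tree's vocabulary from the idèle
class formation (Milne, *Arithmetic Duality Theorems* I §2, §4; Tate, ICM 1962; Harari 2020 Ch. 17–18; Serre, Durham 1977 §6): the named facts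
`Literature.NumberTheory.GaloisCohomology.poitouTate_sha_tateDual` (PT (ii): `Ш¹(K, M)` and `Ш¹(K, M^D)` are exact annihilators, `PoitouTateSha.lean`),
`…poitouTate_sha_zmod_mu` (its `ℤ/m` / `μ_m` instance), `…poitouTate_three_realPlaces_injective` (Milne I Thm. 4.10 (c), degree 3,
`PoitouTateRealPlacesHigherDegree.lean`), `…poitouTate_selmerStructure_duality_conj` (duality for Selmer structures with conjugation-compatible
canonical invariants, `PoitouTateSelmerStructuresConj.lean`), `Literature.NumberTheory.GaloisRepresentations.Patrikis2019_exists_lift_projective` / `…_exists_spinLift` /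
`…_exists_spinLift_of_continuous` (Tate's `H²(Γ_K, ℚ/ℤ) = 0` and Patrikis' lifting statements, `ProjectiveLifting.lean`, `TateSpinLift.lean`,
`TateSpinLiftContinuous.lean`) and `Literature.NumberTheory.GaloisCohomology.Howard2004.prop141_casselsTate_skewPairing_atLevel_printIntended` /
`…thm161_dvrKolyvaginBound_printIntended` (Howard 2004 Prop. 1.4.1 / Thm. 1.6.1 as intended, `Howard2004/`) HOLD — EXACT names `<fact>_holds`
(files 2 and 7 of 7).**  Contents: (1, definitions file) annihilators under a perfect `ℤ/n`-valued pairing of finite abelian groups and their counting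
(Milne I §0), descent of `2`-cocycles through an open normal subgroup, the trivial module `ℤ/m` versus `μ_m` (transport maps); (2) `Ш³` and
`H³(K, M) → ⊕_{v real}` injectivity via the Brauer group (`H³(Γ_K, K̄ˣ) = 0`, odd descent, Sylow fields); (3) unramified local conditions,
inertia and the unramified subgroup, local Tate pairing vanishing on unramified classes, exact orthogonality at almost all places, bidual transport,
the all-places reduction, presentation read-out and the reciprocity equality; (4) finiteness of Selmer groups, finite duality of `Ш`-duals, new places,
`Ш²` read-out roads, weak Leopoldt; (5) the real-place corrections, native `Ш²` assembly, presentation pairings, the idèle package and the reciprocity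
sum; (6) local duality at every place, the Selmer-complement reduction, unramified orthogonality at all levels, the all-places reduction, the
middle-exact dual symmetry; (7) `Ш¹`-duality `poitouTate_sha_tateDual_holds`, the `ℤ/m`–`μ_m` instance, `H²`-finite support, Tate's theorem
`H²(Γ_K, ℚ/ℤ) = 0` for every number field and the Patrikis / Howard / Selmer-structure discharges.
RE-HOMED into `Literature/` by the Hodge foundations lane (`lit-hodgefound`, seat p20, generation 40): verbatim DECLARATION-LEVEL ports (the 221
declarations needed, in dependency order; each Part is a slice of one Summits module) of 63 modules
`Summits/BirchSwinnertonDyer/BirchSwinnertonDyer/Theorems/{SchneiderFreeAdditiveX3PoitouTate*,SchneiderFreeAdditiveX3TateH2VanishingAllNumberFields,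
CumulativeHeegnerLeopoldtRedSplitControlAtThreeSha*,ThetaPartnerAtTwoSignedControlAtTwo{MuReal*,ShaTwo*,ShaThree*,GlobalHTwoFiniteSupport},
KolyvaginRoadThreePTDevissageCofinite,PoitouTateSelmerStructureDualityConjHolds,Howard{Thm161PrintIntendedOfProp141Intended,FlachSkewPairingAtLevelIntendedHolds}}.lean`
and `Summits/BirchSwinnertonDyer/Rank1Residual/{X11b,GaloisImage}/*.lean`; the namespaces `Summit.BirchSwinnertonDyer.BirchSwinnertonDyer.Theorems[.SchneiderFreeAdditiveX3]`
and `Summit.BirchSwinnertonDyer.Rank1Residual` are re-rooted at `Literature.NumberTheory.GaloisCohomology.PoitouTateFinite` (sub-namespaces `PoitouTateReduction`,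
`PoitouTateShaTwoReadout`, `PoitouTateShaAnnihilator`, `SignedEC.*`, `KolyvaginRoadThreePT`, `InputsPoitouTateSelmer`, `Howard*`, `GaloisImage.*` kept; the route-item
segment `X11b` is dropped: `…X11b.{FiniteDuality,Levels,LocBridge,H2Support,ShaBound,WeakLeopoldt}` ↦ `PoitouTateFinite.{…}`);
four lemmas of `X11b/MaxUnramifiedRestriction.lean` already in `Literature/NumberTheory/GaloisRepresentations/UnramifiedClassesInertia.lean` are used from
there; the nine `_holds` theorems carry the EXACT names.  Built on the tree's Literature layer (`Literature/NumberTheory/{GaloisRepresentations,GaloisCohomology,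
Automorphic,EllipticCurves}/…`, `Literature/Algebra/Homology/…`, `Literature/AnabelianGeometry/AbsoluteAnabelian/…`).  No new named fact (D-0026); imports
Mathlib/Literature only; every declaration carries the citation of the printed statement it formalises or serves.  The Summits originals stay in
place (transitional duplication).  WHAT THIS IS NOT: nothing here bears on the Birch–Swinnerton-Dyer conjecture or any summit statement; it is
classical Poitou–Tate duality for finite modules (1960s) re-proved in the tree's vocabulary.
-/

noncomputable section

/-!
## Part 1 — port of `Summits/BirchSwinnertonDyer/Rank1Residual/GaloisImage/PrimeChoiceLocal.lean` (1 declarations kept)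

# The prime-choice local criterion: `loc_v [c] = 0 ↔ c(Frob_v) ∈ (Frob_v − 1)T̄` for an unramified class

Declarations of this Part (verbatim port; each keeps its own docstring and citation): `localization_inr_oneCocycleClass`.

Reference keys (see `references.bib` and the declarations' citations): [SerreGaloisCohomology1997].
-/

section Part1

open _root_.Function _root_.Field _root_.NumberField _root_.IsDedekindDomain ValuativeRel
open Literature.NumberTheory.GaloisRepresentations
open Literature.NumberTheory.GaloisRepresentations.IsNonarchimedeanLocalField
open scoped _root_.NumberField _root_.Pointwise

universe u

namespace Literature.NumberTheory.GaloisCohomology.PoitouTateFinite.GaloisImage.PrimeChoice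

section Global

variable {K : Type u} [Field K] [NumberField K] {M : Type u} [AddCommGroup M] [TopologicalSpace M]
  [DiscreteTopology M] (ρ : DiscreteGaloisModule K M)

/-- The localisation at a finite place on classes of continuous crossed homomorphisms:
`loc_v [c] = [c ∘ res_v]` (`map_oneCocycleClass`; `res_v = absGaloisRestrict K K_v`).
[cite: SerreGaloisCohomology1997, Ch. I §2.4 (functoriality of cohomology in the pair (group, module))] -/
theorem localization_inr_oneCocycleClass (v : HeightOneSpectrum (𝓞 K))
    (c : contOneCocycles ρ.toTopRep) :
    galoisCohomology.localization ρ (Sum.inr v) 1 (oneCocycleClass ρ.toTopRep c) =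
      oneCocycleClass (DiscreteGaloisModule.toTopRep (GaloisRep.restrictField (v.adicCompletion K) ρ))
        (contOneCocycles.pullback (absGaloisRestrict K (v.adicCompletion K))
          (X := ρ.toTopRep)
          (Y := DiscreteGaloisModule.toTopRep (GaloisRep.restrictField (v.adicCompletion K) ρ))
          (TopRep.ofHom ⟨ContinuousLinearMap.id ℤ M, fun _ => rfl⟩) c) :=
  map_oneCocycleClass _ _ _ c

end Global

end Literature.NumberTheory.GaloisCohomology.PoitouTateFinite.GaloisImage.PrimeChoice

end Part1

/-!
## Part 2 — port of `Summits/BirchSwinnertonDyer/Rank1Residual/GaloisImage/SelmerClassInertia.lean` (5 declarations kept)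

# A Selmer class unramified at `v` is represented by a crossed homomorphism vanishing on every inertia group above `v`

Declarations of this Part (verbatim port; each keeps its own docstring and citation): `maxUnramified_normal`, `apply_eq_zero_of_mem_absInertia`, `apply_conj_eq_of_apply_eq_one`, `apply_eq_zero_of_mem_inertia_of_localization_mem`, `apply_eq_zero_of_mem_inertia_of_mem_selmerGroup`.

Reference keys (see `references.bib` and the declarations' citations): [SerreGaloisCohomology1997].
-/

section Part2

open scoped _root_.NumberField _root_.Pointwise
open _root_.Function _root_.Field _root_.NumberField _root_.IsDedekindDomain
open Literature.NumberTheory.GaloisRepresentations Literature.NumberTheory.GaloisRepresentations.DiscreteGaloisModule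
  Literature.NumberTheory.GaloisRepresentations.IsNonarchimedeanLocalField

universe u

namespace Literature.NumberTheory.GaloisCohomology.PoitouTateFinite.GaloisImage.SelmerFinite

/-! ## §1. The local statement over a non-archimedean local field -/

section Local

variable {F : Type u} [Field F] [ValuativeRel F] [TopologicalSpace F] [IsNonarchimedeanLocalField F]

omit [TopologicalSpace F] [IsNonarchimedeanLocalField F] in
/-- `F^{nr} = F(μ_{p'}) ⊆ F̄` is a normal extension of `F`: every `F`-automorphism of `F̄` permutes
the prime-to-`p` roots of unity (Serre, *Local Fields*, Ch. IV §4). [cite: SerreGaloisCohomology1997, Ch. II §5.5 (unramified cohomology)] -/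
theorem maxUnramified_normal : Normal F (maxUnramified F) := by
  rw [IntermediateField.normal_iff_forall_map_le']
  intro σ
  rw [maxUnramified, IntermediateField.adjoin_map]
  refine IntermediateField.adjoin.mono F _ _ ?_
  rintro _ ⟨ζ, hζ, rfl⟩
  obtain ⟨N, hN, hζN⟩ := mem_primeToPRootsOfUnity_iff.mp hζ
  exact mem_primeToPRootsOfUnity_iff.mpr ⟨N, hN, by rw [AlgEquiv.coe_toAlgHom, ← map_pow, hζN, map_one]⟩

variable {M : Type u} [AddCommGroup M] [TopologicalSpace M] [DiscreteTopology M]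

/-- **An unramified class of an unramified module is represented by a crossed homomorphism
vanishing on the inertia group.**  If `I_F` acts trivially on `M` and the class of `f` lies in
`H¹_ur(F, M) = ker (H¹(F, M) → H¹(F^{nr}, M))`, then `f(t) = 0` for every `t ∈ I_F`: the pull-back
of `f` to `Γ_{F^{nr}}` is principal, `f(t) = t·w − w`, and `t` acts trivially; and `Γ_{F^{nr}} → Γ_F`
is onto `I_F = Gal(F̄/F^{nr})`. [cite: SerreGaloisCohomology1997, Ch. II §5.5 (unramified cohomology)] -/
theorem apply_eq_zero_of_mem_absInertia (τ : DiscreteGaloisModule F M)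
    (hI : ∀ t ∈ absInertia F, τ t = 1) (f : contOneCocycles τ.toTopRep)
    (hf : oneCocycleClass τ.toTopRep f ∈ unramifiedSubgroup τ 1) :
    ∀ t ∈ absInertia F, f.1 t = 0 := by
  haveI : Normal F (maxUnramified F) := maxUnramified_normal
  set E := maxUnramified F with hE
  replace hf := (mem_unramifiedSubgroup_iff τ 1 _).mp hf
  have hres : galoisCohomology.res τ E 1 (oneCocycleClass τ.toTopRep f) =
      oneCocycleClass (DiscreteGaloisModule.toTopRep (GaloisRep.restrictField E τ))
        (contOneCocycles.pullback (absGaloisRestrict F E) (X := τ.toTopRep)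
          (Y := DiscreteGaloisModule.toTopRep (GaloisRep.restrictField E τ))
          (TopRep.ofHom ⟨ContinuousLinearMap.id ℤ M, fun _ => rfl⟩) f) :=
    map_oneCocycleClass _ _ _ f
  rw [hres] at hf
  obtain ⟨w, hw⟩ := (oneCocycleClass_eq_zero_iff _ _).mp hf
  -- the image of `Γ_{F^{nr}}` is `I_F`, which acts trivially
  have hfix : ∀ t' : absoluteGaloisGroup E, absGaloisRestrict F E t' ∈ absInertia F := fun t' =>
    mem_absInertia_iff_forall_mem_maxUnramified.mpr
      ((mem_absGaloisFixingSubgroup_iff E _).mp (absGaloisRestrict_mem_absGaloisFixingSubgroup F E t'))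
  have hval : ∀ t' : absoluteGaloisGroup E, f.1 (absGaloisRestrict F E t') = 0 := fun t' => by
    have h := hw t'
    rw [contOneCocycles.pullback_apply] at h
    change f.1 (absGaloisRestrict F E t') = τ (absGaloisRestrict F E t') w - w at h
    rw [hI _ (hfix t'), Module.End.one_apply, sub_self] at h
    exact h
  intro t ht
  obtain ⟨t', rfl⟩ := exists_absGaloisRestrict_eq F E t
    ((mem_absGaloisFixingSubgroup_iff E t).mpr (mem_absInertia_iff_forall_mem_maxUnramified.mp ht))
  exact hval t'

end Local

/-! ## §2. Conjugation, and the global statement over a number field -/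

section Global

variable {K : Type u} [Field K] [NumberField K]
variable {M : Type u} [AddCommGroup M] [TopologicalSpace M] [DiscreteTopology M]
variable (ρ : DiscreteGaloisModule K M)

omit [NumberField K] in
/-- `f(g h g⁻¹) = g · f(h)` for a crossed homomorphism `f` and `h` acting trivially on `M`
(`f(g) + g·f(g⁻¹) = f(1) = 0`). [cite: SerreGaloisCohomology1997, Ch. II §5.5 (unramified cohomology)] -/
theorem apply_conj_eq_of_apply_eq_one (f : contOneCocycles ρ.toTopRep) {g h : absoluteGaloisGroup K}
    (hh : ρ h = 1) : f.1 (g * h * g⁻¹) = ρ g (f.1 h) := by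
  have h1 := f.2 (g * h) g⁻¹
  have h2 := f.2 g h
  have h3 := f.2 g g⁻¹
  rw [mul_inv_cancel, contOneCocycles.apply_one] at h3
  change f.1 (g * h * g⁻¹) = f.1 (g * h) + ρ (g * h) (f.1 g⁻¹) at h1
  change f.1 (g * h) = f.1 g + ρ g (f.1 h) at h2
  change (0 : M) = f.1 g + ρ g (f.1 g⁻¹) at h3
  rw [h1, h2, map_mul, hh, mul_one, add_assoc, add_comm (ρ g (f.1 h)), ← add_assoc, ← h3, zero_add]

/-- **A crossed homomorphism whose class is unramified at `v` vanishes on every inertia group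
above `v`**, for `M` unramified at `v`: at the prime `𝔓₀` of the completion (`I_{𝔓₀}` is the image
of `I_{K_v}`, `inertia_adicCompletionPrime_eq_map_absInertia`, and the local statement
`apply_eq_zero_of_mem_absInertia`), then at every `𝔓 = γ • 𝔓₀` by conjugation
(`apply_conj_eq_of_apply_eq_one`; the primes above `v` are conjugate). [cite: SerreGaloisCohomology1997, Ch. II §5.5 (unramified cohomology)] -/
theorem apply_eq_zero_of_mem_inertia_of_localization_mem {v : HeightOneSpectrum (𝓞 K)}
    (hunr : GaloisRep.IsUnramifiedAt v ρ) (f : contOneCocycles ρ.toTopRep)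
    (hf : galoisCohomology.localization ρ (Sum.inr v) 1 (oneCocycleClass ρ.toTopRep f) ∈
      unramifiedSubgroup (GaloisRep.toLocal v ρ) 1) :
    ∀ 𝔓 ∈ v.primesAbove, ∀ σ ∈ 𝔓.inertia (absoluteGaloisGroup K), f.1 σ = 0 := by
  set L := v.adicCompletion K with hL
  set res := absGaloisRestrict K L with hres_def
  have h𝔓₀ := adicCompletionPrime_mem_primesAbove K v
  -- Step 1: `f` vanishes on `I_{𝔓₀} = res (I_{K_v})`
  have hIρ : ∀ t ∈ absInertia L, GaloisRep.toLocal v ρ t = 1 :=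
    (GaloisRep.isUnramifiedAt_iff_toLocal_holds v ρ).1 hunr
  rw [PrimeChoice.localization_inr_oneCocycleClass] at hf
  have hloc := apply_eq_zero_of_mem_absInertia (GaloisRep.toLocal v ρ) hIρ _ hf
  have h0 : ∀ σ ∈ (adicCompletionPrime K v).inertia (absoluteGaloisGroup K), f.1 σ = 0 := by
    intro σ hσ
    rw [inertia_adicCompletionPrime_eq_map_absInertia] at hσ
    obtain ⟨t, ht, rfl⟩ := Subgroup.mem_map.mp hσ
    have := hloc t ht
    rwa [contOneCocycles.pullback_apply] at this
  -- Step 2: every `𝔓 ∣ v` is conjugate to `𝔓₀`: `δ • 𝔓 = 𝔓₀`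
  intro 𝔓 h𝔓 σ hσ
  obtain ⟨δ, hδ⟩ := HeightOneSpectrum.exists_smul_eq_of_mem_primesAbove_holds h𝔓 h𝔓₀
  have hσ' : δ * σ * δ⁻¹ ∈ (adicCompletionPrime K v).inertia (absoluteGaloisGroup K) := by
    have h := conj_mem_inertia_smul hσ δ
    rwa [hδ] at h
  have hρσ' : ρ (δ * σ * δ⁻¹) = 1 := hunr _ h𝔓₀ _ hσ'
  have hfσ' : f.1 (δ * σ * δ⁻¹) = 0 := h0 _ hσ'
  have hσeq : σ = δ⁻¹ * (δ * σ * δ⁻¹) * δ⁻¹⁻¹ := by group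
  rw [hσeq, apply_conj_eq_of_apply_eq_one ρ f hρσ', hfσ', map_zero]

/-- The same for a Selmer class of a Selmer structure that is UNRAMIFIED at `v`
(`𝓕_v = H¹_ur(K_v, M)`). [cite: SerreGaloisCohomology1997, Ch. II §5.5 (unramified cohomology)] -/
theorem apply_eq_zero_of_mem_inertia_of_mem_selmerGroup {𝓕 : SelmerStructure ρ}
    {v : HeightOneSpectrum (𝓞 K)} (hunr : GaloisRep.IsUnramifiedAt v ρ)
    (h𝓕v : 𝓕 (Sum.inr v) = unramifiedSubgroup (GaloisRep.toLocal v ρ) 1)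
    (f : contOneCocycles ρ.toTopRep) (hf : oneCocycleClass ρ.toTopRep f ∈ 𝓕.selmerGroup) :
    ∀ 𝔓 ∈ v.primesAbove, ∀ σ ∈ 𝔓.inertia (absoluteGaloisGroup K), f.1 σ = 0 := by
  refine apply_eq_zero_of_mem_inertia_of_localization_mem ρ hunr f ?_
  have h := (SelmerStructure.mem_selmerGroup_iff _ _).mp hf (Sum.inr v)
  rwa [h𝓕v] at h

end Global

end Literature.NumberTheory.GaloisCohomology.PoitouTateFinite.GaloisImage.SelmerFinite

end Part2

/-!
## Part 3 — port of `Summits/BirchSwinnertonDyer/Rank1Residual/GaloisImage/SelmerGroupFinite.lean` (5 declarations kept)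

# Selmer groups of FINITE Galois modules with unramified local conditions outside a finite set are finite

Declarations of this Part (verbatim port; each keeps its own docstring and citation): `apply_inv_eq_zero`, `exists_subgroup_carrier_eq`, `isOpen_setOf_apply_eq_one`, `finite_selmerGroup_of_unramified_outside`, `finite_selmerGroup_of_isUnramifiedOutside`.

Reference keys (see `references.bib` and the declarations' citations): [NeukirchSchmidtWingberg2008].
-/

section Part3

open scoped _root_.NumberField _root_.Pointwise
open _root_.Function _root_.Field _root_.NumberField _root_.IsDedekindDomain
open Literature.NumberTheory.GaloisRepresentations Literature.NumberTheory.GaloisRepresentations.DiscreteGaloisModule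

universe u

namespace Literature.NumberTheory.GaloisCohomology.PoitouTateFinite.GaloisImage.SelmerFinite

variable {K : Type u} [Field K] [NumberField K]
variable {M : Type u} [AddCommGroup M] [TopologicalSpace M] [DiscreteTopology M]
variable (ρ : DiscreteGaloisModule K M)

/-! ## §1. The open normal subgroup `V_f = {ρ = 1, f = 0}` of a crossed homomorphism -/

omit [NumberField K] in
/-- `f(g⁻¹) = 0` when `ρ(g) = 1` and `f(g) = 0`. [cite: NeukirchSchmidtWingberg2008, (8.3.20) (finiteness of H¹(G_S, M)); MilneADT2006, Ch. I §4 (Lemma 4.8 ff.)] -/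
theorem apply_inv_eq_zero (f : contOneCocycles ρ.toTopRep) {g : absoluteGaloisGroup K}
    (hg : ρ g = 1) (hfg : f.1 g = 0) : f.1 g⁻¹ = 0 := by
  have h := f.2 g g⁻¹
  rw [mul_inv_cancel, contOneCocycles.apply_one] at h
  change (0 : M) = f.1 g + ρ g (f.1 g⁻¹) at h
  rw [hfg, zero_add, hg, Module.End.one_apply] at h
  exact h.symm

omit [NumberField K] in
/-- The subset `V_f = {g : ρ(g) = 1 ∧ f(g) = 0}` is a subgroup; packaged as: there is a subgroup
with exactly this carrier. [cite: NeukirchSchmidtWingberg2008, (8.3.20) (finiteness of H¹(G_S, M)); MilneADT2006, Ch. I §4 (Lemma 4.8 ff.)] -/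
theorem exists_subgroup_carrier_eq (f : contOneCocycles ρ.toTopRep) :
    ∃ V : Subgroup (absoluteGaloisGroup K), (V : Set (absoluteGaloisGroup K)) = {g | ρ g = 1 ∧ f.1 g = 0} := by
  refine ⟨{ carrier := {g | ρ g = 1 ∧ f.1 g = 0}
            mul_mem' := fun {a b} ha hb => ⟨by rw [map_mul, ha.1, hb.1, mul_one], ?_⟩
            one_mem' := ⟨map_one ρ, contOneCocycles.apply_one f⟩
            inv_mem' := fun {a} ha =>
              ⟨by
                  have h1 : ρ (a⁻¹ * a) = 1 := by rw [inv_mul_cancel, map_one]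
                  rwa [map_mul, ha.1, mul_one] at h1,
                apply_inv_eq_zero ρ f ha.1 ha.2⟩ }, rfl⟩
  have h := f.2 a b
  change f.1 (a * b) = f.1 a + ρ a (f.1 b) at h
  rw [h, ha.2, hb.2, map_zero, add_zero]

omit [NumberField K] in
/-- `{g : ρ(g) = 1}` is open for a finite discrete module. [cite: NeukirchSchmidtWingberg2008, (8.3.20) (finiteness of H¹(G_S, M)); MilneADT2006, Ch. I §4 (Lemma 4.8 ff.)] -/
theorem isOpen_setOf_apply_eq_one [Finite M] : IsOpen {g : absoluteGaloisGroup K | ρ g = 1} := by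
  have h : {g : absoluteGaloisGroup K | ρ g = 1} = ⋂ m : M, {g | ρ g m = m} := by
    ext g
    simp only [Set.mem_setOf_eq, Set.mem_iInter]
    exact ⟨fun hg m => by rw [hg, Module.End.one_apply], fun hg => LinearMap.ext hg⟩
  rw [h]
  exact isOpen_iInter_of_finite fun m => ρ.isOpen_setOf_apply_eq m

/-! ## §2. Finiteness -/

/-- **`H¹_𝓕(K, M)` is finite for a finite module with unramified local conditions outside a finite
set `S ⊇ Ram(M)` of finite places** (Milne *ADT* I §4; NSW (8.3.20)). [cite: NeukirchSchmidtWingberg2008, (8.3.20) (finiteness of H¹(G_S, M)); MilneADT2006, Ch. I §4 (Lemma 4.8 ff.)] -/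
theorem finite_selmerGroup_of_unramified_outside [Finite M] {S : Set (HeightOneSpectrum (𝓞 K))}
    (hS : S.Finite) (hunr : ∀ v ∉ S, GaloisRep.IsUnramifiedAt v ρ) {𝓕 : SelmerStructure ρ}
    (h𝓕 : ∀ v ∉ S, 𝓕 (Sum.inr v) = unramifiedSubgroup (GaloisRep.toLocal v ρ) 1) :
    Finite 𝓕.selmerGroup := by
  classical
  -- the open subgroup `U₀ = ker ρ` and the index bound `n`
  obtain ⟨U₀, hU₀⟩ := exists_subgroup_carrier_eq ρ 0
  have hU₀mem : ∀ g, g ∈ U₀ ↔ ρ g = 1 := fun g => by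
    rw [← SetLike.mem_coe, hU₀]
    exact ⟨fun h => h.1, fun h => ⟨h, rfl⟩⟩
  set n := Nat.card M * U₀.index with hn
  -- the finite set of admissible open normal subgroups
  set 𝒩 := {N : Subgroup (absoluteGaloisGroup K) | IsOpen (N : Set (absoluteGaloisGroup K)) ∧ N.Normal ∧
      ramificationSubgroup K S ≤ N ∧ N.index ≤ n} with h𝒩
  have h𝒩fin : 𝒩.Finite := finite_setOf_isOpen_normal_ramificationSubgroup_le K hS n
  -- functions factoring through some `N ∈ 𝒩`
  set T : Set (absoluteGaloisGroup K → M) :=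
    ⋃ N ∈ 𝒩, Set.range fun ψ : absoluteGaloisGroup K ⧸ N → M => ψ ∘ QuotientGroup.mk with hT
  have hTfin : T.Finite := by
    refine h𝒩fin.biUnion fun N hN => ?_
    haveI : Finite (absoluteGaloisGroup K ⧸ N) := Subgroup.quotient_finite_of_isOpen N hN.1
    exact Set.finite_range _
  -- every cocycle of a Selmer class lies in `T`
  have hmain : ∀ f : contOneCocycles ρ.toTopRep, oneCocycleClass ρ.toTopRep f ∈ 𝓕.selmerGroup →
      (f.1 : absoluteGaloisGroup K → M) ∈ T := by
    intro f hf
    obtain ⟨V, hV⟩ := exists_subgroup_carrier_eq ρ f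
    have hVmem : ∀ g, g ∈ V ↔ ρ g = 1 ∧ f.1 g = 0 := fun g => by rw [← SetLike.mem_coe, hV]; rfl
    -- `V` is open
    have hVopen : IsOpen (V : Set (absoluteGaloisGroup K)) := by
      rw [hV, Set.setOf_and]
      exact (isOpen_setOf_apply_eq_one ρ).inter
        ((isOpen_discrete ({0} : Set M)).preimage f.1.continuous)
    -- `V` is normal
    haveI hVnormal : V.Normal := ⟨fun h hh g => by
      rw [hVmem] at hh ⊢
      refine ⟨by rw [map_mul, map_mul, hh.1, mul_one, ← map_mul, mul_inv_cancel, map_one], ?_⟩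
      rw [apply_conj_eq_of_apply_eq_one ρ f hh.1, hh.2, map_zero]⟩
    -- `N_S ≤ V`
    have hNS : ramificationSubgroup K S ≤ V := by
      have hker : (QuotientGroup.mk' V).ker = V := QuotientGroup.ker_mk' V
      have h := ramificationSubgroup_le_ker (S := S) (QuotientGroup.mk' V) (by rw [hker]; exact hVopen)
        (fun v hv 𝔓 h𝔓 σ hσ => by
          rw [← MonoidHom.mem_ker, hker, hVmem]
          exact ⟨hunr v hv 𝔓 h𝔓 σ hσ,
            apply_eq_zero_of_mem_inertia_of_mem_selmerGroup ρ (hunr v hv) (h𝓕 v hv) f hf 𝔓 h𝔓 σ hσ⟩)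
      rwa [hker] at h
    -- index bound: `V ≤ U₀`, `[U₀ : V] ≤ #M` via the homomorphism `u ↦ f(u)` on `U₀`
    have hVU : V ≤ U₀ := fun g hg => (hU₀mem g).mpr ((hVmem g).mp hg).1
    have hindex : V.index ≤ n := by
      let φ : U₀ →* Multiplicative M :=
        { toFun := fun u => Multiplicative.ofAdd (f.1 u)
          map_one' := by rw [OneMemClass.coe_one, contOneCocycles.apply_one]; rfl
          map_mul' := fun a b => by
            have h := f.2 a b
            change f.1 (a * b) = f.1 a + ρ a (f.1 b) at h
            rw [← ofAdd_add, Subgroup.coe_mul, h, (hU₀mem a).mp a.2, Module.End.one_apply] }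
      have hkerφ : φ.ker = V.subgroupOf U₀ := by
        ext u
        rw [MonoidHom.mem_ker, Subgroup.mem_subgroupOf, hVmem]
        change Multiplicative.ofAdd (f.1 u) = 1 ↔ _
        rw [ofAdd_eq_one]
        exact ⟨fun h => ⟨(hU₀mem u).mp u.2, h⟩, fun h => h.2⟩
      have hrel : V.relIndex U₀ ≤ Nat.card M := by
        rw [Subgroup.relIndex, ← hkerφ, Subgroup.index_ker]
        exact Nat.card_le_card_of_injective (fun x : φ.range => (x : Multiplicative M))
          Subtype.val_injective
      rw [← Subgroup.relIndex_mul_index hVU, hn]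
      exact Nat.mul_le_mul_right _ hrel
    -- so `V ∈ 𝒩`, and `f` factors through `Γ_K / V`
    have hV𝒩 : V ∈ 𝒩 := ⟨hVopen, hVnormal, hNS, hindex⟩
    refine Set.mem_biUnion hV𝒩 ⟨fun q => f.1 q.out, funext fun g => ?_⟩
    change f.1 (QuotientGroup.mk g : absoluteGaloisGroup K ⧸ V).out = f.1 g
    obtain ⟨v, hv⟩ := QuotientGroup.mk_out_eq_mul V g
    rw [hv]
    have h := f.2 g v
    change f.1 (g * v) = f.1 g + ρ g (f.1 v) at h
    rw [h, ((hVmem v).mp v.2).2, map_zero, add_zero]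
  -- conclude: classes inject into the finite set `T` through chosen cocycles
  haveI : Finite T := hTfin.to_subtype
  refine Finite.of_injective (fun c : 𝓕.selmerGroup =>
    (⟨((oneCocycleClass_surjective ρ.toTopRep c.1).choose.1 : absoluteGaloisGroup K → M),
      hmain _ (by rw [(oneCocycleClass_surjective ρ.toTopRep c.1).choose_spec]; exact c.2)⟩ : T))
    fun c c' h => ?_
  have h' : ((oneCocycleClass_surjective ρ.toTopRep c.1).choose.1 : absoluteGaloisGroup K → M) =
      (oneCocycleClass_surjective ρ.toTopRep c'.1).choose.1 := congrArg Subtype.val h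
  have hcoc : (oneCocycleClass_surjective ρ.toTopRep c.1).choose =
      (oneCocycleClass_surjective ρ.toTopRep c'.1).choose :=
    Subtype.ext (ContinuousMap.ext fun g => congrFun h' g)
  apply Subtype.ext
  rw [← (oneCocycleClass_surjective ρ.toTopRep c.1).choose_spec,
    ← (oneCocycleClass_surjective ρ.toTopRep c'.1).choose_spec, hcoc]

/-- The `Finset (Place K)` / `IsUnramifiedOutside` reading (the `hfin` binder of the Kolyvagin-system
files): for a finite discrete module unramified outside `S` and a Selmer structure unramified outside
`S`, `H¹_𝓕(K, M)` is finite. [cite: NeukirchSchmidtWingberg2008, (8.3.20) (finiteness of H¹(G_S, M)); MilneADT2006, Ch. I §4 (Lemma 4.8 ff.)] -/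
theorem finite_selmerGroup_of_isUnramifiedOutside [Finite M] {S : Finset (Place K)}
    (hS : ∀ v : HeightOneSpectrum (𝓞 K), (Sum.inr v : Place K) ∉ S → GaloisRep.IsUnramifiedAt v ρ)
    {𝓕 : SelmerStructure ρ} (h𝓕 : 𝓕.IsUnramifiedOutside S) : Finite 𝓕.selmerGroup := by
  refine finite_selmerGroup_of_unramified_outside ρ (S := {v | (Sum.inr v : Place K) ∈ S})
    ((S.finite_toSet.preimage Sum.inr_injective.injOn).subset fun v hv => hv) (fun v hv => hS v hv)
    fun v hv => h𝓕.2 v hv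

end Literature.NumberTheory.GaloisCohomology.PoitouTateFinite.GaloisImage.SelmerFinite

end Part3

/-!
## Part 4 — port of `Summits/BirchSwinnertonDyer/BirchSwinnertonDyer/Theorems/CumulativeHeegnerLeopoldtRedSplitControlAtThreeShaDualFiniteDuality.lean` (4 declarations kept)

# Poitou–Tate, the annihilator of `Ш¹` — part 1/3: finite duality, stabilisation of `Ш¹_S`, and the representation of a functional on the classes unramified outside `S` (Milne I Thm. 4.10, proof, p. 58)

Declarations of this Part (verbatim port; each keeps its own docstring and citation): `exists_finset_forall_apply_eq_zero`, `exists_apply_eq_of_bijective`, `exists_finset_forall_localization_eq_zero`, `exists_sum_localTatePairingZMod_eq_of_unramifiedOutside`.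

Reference keys (see `references.bib` and the declarations' citations): [MilneADT2006].
-/

section Part4

open _root_.Function _root_.NumberField _root_.IsDedekindDomain
open scoped _root_.NumberField

universe u

set_option autoImplicit false

namespace Literature.NumberTheory.GaloisCohomology.PoitouTateFinite.PoitouTateShaAnnihilator

open Literature.NumberTheory.GaloisRepresentations
open Literature.NumberTheory.GaloisRepresentations.DiscreteGaloisModule (mu localTatePairingZMod tateDual
  unramifiedSubgroup SelmerStructure)
open Literature.NumberTheory.GaloisCohomology

section Algebra

/-- **A finite subgroup that dies under a family of homomorphisms already dies under finitely many of
them, uniformly**: for `G ≤ A` finite and homomorphisms `f_i : A → B_i`, there is a finite set `T` of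
indices such that every `x ∈ G` killed by the `f_i`, `i ∈ T`, is killed by all `f_i` (choose a
witness index for each of the finitely many `x ∈ G` outside the common kernel). [cite: MilneADT2006, Ch. I §0 Prop. 0.19] -/
theorem exists_finset_forall_apply_eq_zero {A : Type*} [AddCommGroup A] {ι : Type*} {B : ι → Type*}
    [∀ i, AddCommGroup (B i)] (f : ∀ i, A →+ B i) (G : AddSubgroup A) [Finite G] :
    ∃ T : Finset ι, ∀ x ∈ G, (∀ i ∈ T, f i x = 0) → ∀ i, f i x = 0 := by
  classical
  have key : ∀ x : G, ∃ T : Finset ι, (∀ i ∈ T, f i x = 0) → ∀ i, f i x = 0 := by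
    intro x
    by_cases h : ∀ i, f i x = 0
    · exact ⟨∅, fun _ => h⟩
    · simp only [not_forall] at h
      obtain ⟨i, hi⟩ := h
      exact ⟨{i}, fun hT => absurd (hT i (Finset.mem_singleton_self i)) hi⟩
  choose T hT using key
  haveI := Fintype.ofFinite G
  refine ⟨Finset.univ.biUnion T, fun x hx hzero i => hT ⟨x, hx⟩ (fun j hj => hzero j ?_) i⟩
  exact Finset.mem_biUnion.2 ⟨⟨x, hx⟩, Finset.mem_univ _, hj⟩

/-- **Functionals on a subgroup are represented through a perfect pairing** (the extension property
of `ℤ/n`-valued characters, by counting): for finite `T`, `P` with `n·P = 0` and a bi-additive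
`b : T × P → ℤ/n` whose adjoint `T → Hom(P, ℤ/n)` is bijective, every additive `χ : B₁ → ℤ/n` on a
subgroup `B₁ ≤ P` is `b(t, ·)|_{B₁}` for some `t ∈ T`: the restriction `T → Hom(B₁, ℤ/n)` has kernel
the annihilator `U` of `B₁`, `#U · #B₁ = #P = #T` (`natCard_annihilator_mul_natCard`), so its image
has `#B₁ = #Hom(B₁, ℤ/n)` elements. [cite: MilneADT2006, Ch. I §0 Prop. 0.19] -/
theorem exists_apply_eq_of_bijective {T P : Type*} [AddCommGroup T] [AddCommGroup P] [Finite T]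
    [Finite P] {n : ℕ} [NeZero n] (hP : ∀ p : P, n • p = 0) (b : T →+ P →+ ZMod n)
    (hb : Bijective b) (B₁ : AddSubgroup P) (χ : B₁ →+ ZMod n) :
    ∃ t : T, ∀ (p : P) (hp : p ∈ B₁), b t p = χ ⟨p, hp⟩ := by
  classical
  -- the restriction map `Θ : T → Hom(B₁, ℤ/n)`
  let Θ : T →+ (B₁ →+ ZMod n) :=
    { toFun := fun t => (b t).comp B₁.subtype
      map_zero' := by ext p; simp
      map_add' := fun t t' => by ext p; simp }
  have hΘ : ∀ t (p : B₁), Θ t p = b t p := fun _ _ => rfl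
  -- its kernel is the annihilator `U` of `B₁`
  have hU : ∀ t : T, t ∈ Θ.ker ↔ ∀ p ∈ B₁, b t p = 0 := fun t => by
    rw [AddMonoidHom.mem_ker]
    constructor
    · intro h p hp
      rw [← hΘ t ⟨p, hp⟩, h, AddMonoidHom.zero_apply]
    · intro h
      ext p
      rw [hΘ, h p p.2, AddMonoidHom.zero_apply]
  have hB₁n : ∀ p : B₁, n • p = 0 := fun p => Subtype.ext (by
    rw [AddSubgroup.coe_nsmul, hP, AddSubgroup.coe_zero])
  haveI : Finite (B₁ →+ ZMod n) := finite_addMonoidHom_zmod B₁ n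
  have h1 : Nat.card Θ.ker * Nat.card B₁ = Nat.card P :=
    natCard_annihilator_mul_natCard hP b hb B₁ Θ.ker hU
  have h2 : Nat.card T = Nat.card P := natCard_eq_of_bijective hP b hb
  have h3 : Nat.card Θ.ker * Θ.ker.index = Nat.card T := AddSubgroup.card_mul_index Θ.ker
  have h4 : Θ.ker.index = Nat.card Θ.range := AddSubgroup.index_ker Θ
  have h5 : Nat.card (B₁ →+ ZMod n) = Nat.card B₁ := Nat.card_addMonoidHom_zmod hB₁n
  have hker0 : Nat.card Θ.ker ≠ 0 := Nat.card_pos.ne'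
  have hrange : Nat.card Θ.range = Nat.card (B₁ →+ ZMod n) := by
    apply Nat.eq_of_mul_eq_mul_left (Nat.pos_of_ne_zero hker0)
    rw [← h4, h3, h2, ← h1, h5]
  have htop : Θ.range = ⊤ := AddSubgroup.eq_top_of_card_eq _ hrange
  have hsurj : Surjective Θ := AddMonoidHom.range_eq_top.1 htop
  obtain ⟨t, ht⟩ := hsurj χ
  exact ⟨t, fun p hp => by rw [← hΘ t ⟨p, hp⟩, ht]⟩

end Algebra

section Stabilization

variable {K : Type u} [Field K] [NumberField K] {M : Type u} [AddCommGroup M] [TopologicalSpace M]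
  [DiscreteTopology M] [Finite M]

/-- **Stabilisation of `Ш¹_S`.** For a finite discrete `Γ_K`-module `M` unramified outside the finite
set of places `S₀ ⊇ {v ∣ ∞}`, the groups `Ш¹_S = {x ∈ H¹(K, M) : x_v = 0 (v ∈ S finite), x_v unramified
(v ∉ S finite)}` decrease with `S ⊇ S₀` inside the FINITE group `Ш¹_{S₀}` (finiteness of Selmer groups,
`SelmerFinite.finite_selmerGroup_of_isUnramifiedOutside`), hence are eventually constant: there is a
finite `S₁ ⊇ S₀` such that every class unramified outside `S₁` and vanishing at the finite places of
`S₁` vanishes at EVERY finite place. [cite: MilneADT2006, Ch. I §4, Lemma 4.8] -/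
theorem exists_finset_forall_localization_eq_zero (ρ : DiscreteGaloisModule K M)
    (S₀ : Finset (Place K)) (hinf : ∀ w : InfinitePlace K, (Sum.inl w : Place K) ∈ S₀)
    (hur : ∀ v : HeightOneSpectrum (𝓞 K), (Sum.inr v : Place K) ∉ S₀ → GaloisRep.IsUnramifiedAt v ρ) :
    ∃ S₁ : Finset (Place K), S₀ ⊆ S₁ ∧ ∀ x : galoisCohomology ρ 1,
      (∀ v : HeightOneSpectrum (𝓞 K), (Sum.inr v : Place K) ∈ S₁ →
        galoisCohomology.localization ρ (Sum.inr v) 1 x = 0) →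
      (∀ v : HeightOneSpectrum (𝓞 K), (Sum.inr v : Place K) ∉ S₁ →
        galoisCohomology.localization ρ (Sum.inr v) 1 x ∈ unramifiedSubgroup (GaloisRep.toLocal v ρ) 1) →
      ∀ v : HeightOneSpectrum (𝓞 K), galoisCohomology.localization ρ (Sum.inr v) 1 x = 0 := by
  classical
  -- the Selmer structure "strict at `S₀`, unramified outside"
  let 𝓢 : SelmerStructure ρ := SelmerStructure.ofFinite ρ fun v =>
    if (Sum.inr v : Place K) ∈ S₀ then ⊥ else unramifiedSubgroup (GaloisRep.toLocal v ρ) 1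
  have h𝓢 : 𝓢.IsUnramifiedOutside S₀ := ⟨hinf, fun v hv => by
    simp only [𝓢, SelmerStructure.ofFinite_inr, if_neg hv]⟩
  haveI : Finite 𝓢.selmerGroup :=
    Literature.NumberTheory.GaloisCohomology.PoitouTateFinite.GaloisImage.SelmerFinite.finite_selmerGroup_of_isUnramifiedOutside
      ρ hur h𝓢
  obtain ⟨T, hT⟩ := exists_finset_forall_apply_eq_zero
    (fun v : HeightOneSpectrum (𝓞 K) => galoisCohomology.localization ρ (Sum.inr v) 1) 𝓢.selmerGroup
  refine ⟨S₀ ∪ T.image Sum.inr, Finset.subset_union_left, fun x hzero hunr => ?_⟩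
  have hx : x ∈ 𝓢.selmerGroup := by
    rw [SelmerStructure.mem_selmerGroup_ofFinite_iff]
    intro v
    by_cases hv : (Sum.inr v : Place K) ∈ S₀
    · rw [if_pos hv, hzero v (Finset.mem_union_left _ hv)]
      exact (⊥ : AddSubgroup _).zero_mem
    · rw [if_neg hv]
      by_cases hv' : (Sum.inr v : Place K) ∈ S₀ ∪ T.image Sum.inr
      · rw [hzero v hv']
        exact AddSubgroup.zero_mem _
      · exact hunr v hv'
  exact hT x hx fun v hv => hzero v (Finset.mem_union_right _ (Finset.mem_image_of_mem _ hv))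

end Stabilization

section OnS

variable {K : Type u} [Field K] [NumberField K] {M : Type u} [AddCommGroup M] [TopologicalSpace M]
  [DiscreteTopology M] [Finite M] {n : ℕ} [NeZero n]

/-- **A functional on the classes unramified outside `S₁` which kills those vanishing on `S₁` is a sum of
local Tate pairings over the finite places of `S₁`.**  For a family `inv` with local Tate duality at the
finite places (`IsPerfect`), a finite `n`-torsion `M`, a finite set of places `S₁` and an additive
`φ : H¹(K, M^D) → ℤ/n` such that `φ(y) = 0` whenever `y` is unramified off `S₁` and `y_v = 0` at the finite
`v ∈ S₁`: there is a vector `t¹ = (t¹_v)_v`, `t¹_v ∈ H¹(K_v, M)`, with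
`φ(y) = ∑_{v ∈ S₁ finite} inv_v (t¹_v ∪ y_v)` for every `y` unramified off `S₁`.  Proof: `φ` restricted to
`A₁ = {y unramified off S₁}` factors through the image of `A₁ → ∏_{v ∈ S₁,f} H¹(K_v, M^D)`; the sum of the
local Tate pairings is a perfect pairing of the finite products (`IsPerfect` at each `v`), and characters of
a subgroup are represented (`exists_apply_eq_of_bijective`).
[cite: MilneADT2006, Ch. I, Cor. 2.3 and Thm. 4.10, proof (p. 58)] -/
theorem exists_sum_localTatePairingZMod_eq_of_unramifiedOutside {inv : LocalInvariants K n}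
    (hperf : inv.IsPerfect) (ρ : DiscreteGaloisModule K M) (hM : ∀ m : M, n • m = 0)
    (S₁ : Finset (Place K)) (φ : galoisCohomology (ρ.tateDual n) 1 →+ ZMod n)
    (hφ : ∀ y : galoisCohomology (ρ.tateDual n) 1,
      (∀ v : HeightOneSpectrum (𝓞 K), (Sum.inr v : Place K) ∉ S₁ →
        galoisCohomology.localization (ρ.tateDual n) (Sum.inr v) 1 y ∈
          unramifiedSubgroup (GaloisRep.toLocal v (ρ.tateDual n)) 1) →
      (∀ v : HeightOneSpectrum (𝓞 K), (Sum.inr v : Place K) ∈ S₁ →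
        galoisCohomology.localization (ρ.tateDual n) (Sum.inr v) 1 y = 0) → φ y = 0) :
    ∃ t1 : Π v : HeightOneSpectrum (𝓞 K), galoisCohomology (ρ.toLocal (Sum.inr v)) 1,
      ∀ y : galoisCohomology (ρ.tateDual n) 1,
        (∀ v : HeightOneSpectrum (𝓞 K), (Sum.inr v : Place K) ∉ S₁ →
          galoisCohomology.localization (ρ.tateDual n) (Sum.inr v) 1 y ∈
            unramifiedSubgroup (GaloisRep.toLocal v (ρ.tateDual n)) 1) →
        φ y = ∑ v ∈ S₁.preimage Sum.inr Sum.inr_injective.injOn,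
          localTatePairingZMod ρ n (Sum.inr v) (inv (Sum.inr v)) (t1 v)
            (galoisCohomology.localization (ρ.tateDual n) (Sum.inr v) 1 y) := by
  classical
  -- the finite part `Sf` of `S₁`, local groups, the perfect sum pairing (as in `PoitouTateSelmerCountProofs`)
  set Sf : Finset (HeightOneSpectrum (𝓞 K)) := S₁.preimage Sum.inr Sum.inr_injective.injOn with hSfdef
  have hSf : ∀ v : HeightOneSpectrum (𝓞 K), v ∈ Sf ↔ (Sum.inr v : Place K) ∈ S₁ := fun v =>
    Finset.mem_preimage
  let Av : Sf → Type u := fun v => galoisCohomology (ρ.toLocal (Sum.inr (v : HeightOneSpectrum (𝓞 K)))) 1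
  let Bv : Sf → Type u := fun v =>
    galoisCohomology ((ρ.tateDual n).toLocal (Sum.inr (v : HeightOneSpectrum (𝓞 K)))) 1
  haveI hfinA : ∀ v : Sf, Finite (Av v) := fun v => finite_galoisCohomology_one_toLocal ρ v
  haveI hfinB : ∀ v : Sf, Finite (Bv v) := fun v => finite_galoisCohomology_one_tateDual_toLocal ρ n v
  let Pv : ∀ v : Sf, Av v →+ Bv v →+ ZMod n :=
    fun v => localTatePairingZMod ρ n (Sum.inr (v : HeightOneSpectrum (𝓞 K))) (inv (Sum.inr v))
  have hPbij : ∀ v : Sf, Bijective (Pv v) := fun v => ((hperf v).2 ρ hM).1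
  have hAn : ∀ t : (∀ v, Av v), n • t = 0 := fun t => funext fun v => by
    rw [Pi.smul_apply, Pi.zero_apply]; exact galoisCohomology.nsmul_eq_zero_of_forall _ hM _
  have hBn : ∀ u : (∀ v, Bv v), n • u = 0 := fun u => funext fun v => by
    rw [Pi.smul_apply, Pi.zero_apply]
    exact galoisCohomology.nsmul_eq_zero_of_forall _ (fun f => DiscreteGaloisModule.TateDual.nsmul_eq_zero f) _
  let bS : (∀ v, Av v) →+ (∀ v, Bv v) →+ ZMod n :=
    ∑ v : Sf, ((Pv v).comp (Pi.evalAddMonoidHom Av v)).compl₂ (Pi.evalAddMonoidHom Bv v)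
  have hbS : ∀ t u, bS t u = ∑ v, Pv v (t v) (u v) := fun t u => by
    simp only [bS, AddMonoidHom.finsetSum_apply, AddMonoidHom.compl₂_apply, AddMonoidHom.comp_apply,
      Pi.evalAddMonoidHom_apply]
  have hbS_single_right : ∀ (t : ∀ v, Av v) (i : Sf) (b : Bv i), bS t (Pi.single i b) = Pv i (t i) b := by
    intro t i b
    rw [hbS, Finset.sum_eq_single i]
    · rw [Pi.single_eq_same]
    · intro j _ hj; rw [Pi.single_eq_of_ne hj, map_zero]
    · intro h; exact absurd (Finset.mem_univ i) h
  have hbS_single_left : ∀ (i : Sf) (a : Av i) (u : ∀ v, Bv v), bS (Pi.single i a) u = Pv i a (u i) := by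
    intro i a u
    rw [hbS, Finset.sum_eq_single i]
    · rw [Pi.single_eq_same]
    · intro j _ hj; rw [Pi.single_eq_of_ne hj, map_zero, AddMonoidHom.zero_apply]
    · intro h; exact absurd (Finset.mem_univ i) h
  have hinj₁ : Injective bS := by
    intro t t' h
    funext i
    apply (hPbij i).1
    ext b
    have := DFunLike.congr_fun h (Pi.single i b)
    rwa [hbS_single_right, hbS_single_right] at this
  have hinj₂ : Injective bS.flip := by
    intro u u' h
    funext i
    apply ((hperf i).2 ρ hM).2.1
    ext a
    have := DFunLike.congr_fun h (Pi.single i a)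
    rw [AddMonoidHom.flip_apply, AddMonoidHom.flip_apply, hbS_single_left, hbS_single_left] at this
    rwa [AddMonoidHom.flip_apply, AddMonoidHom.flip_apply]
  have hbSbij : Bijective bS :=
    (AddMonoidHom.bijective_of_injective_of_injective_flip hAn hBn bS hinj₁ hinj₂).1
  -- the global side: `A₁ = {y unramified off S₁}`, `β₁ : H¹(K, M^D) → ∏_{v ∈ Sf} H¹(K_v, M^D)`
  let 𝓣 : SelmerStructure (ρ.tateDual n) := SelmerStructure.ofFinite (ρ.tateDual n) fun v =>
    if (Sum.inr v : Place K) ∈ S₁ then ⊤ else unramifiedSubgroup (GaloisRep.toLocal v (ρ.tateDual n)) 1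
  have h𝓣top : ∀ v : HeightOneSpectrum (𝓞 K), (Sum.inr v : Place K) ∈ S₁ → 𝓣 (Sum.inr v) = ⊤ :=
    fun v hv => by simp only [𝓣, SelmerStructure.ofFinite_inr, if_pos hv]; rfl
  have h𝓣ur : ∀ v : HeightOneSpectrum (𝓞 K), (Sum.inr v : Place K) ∉ S₁ →
      𝓣 (Sum.inr v) = unramifiedSubgroup (GaloisRep.toLocal v (ρ.tateDual n)) 1 :=
    fun v hv => by simp only [𝓣, SelmerStructure.ofFinite_inr, if_neg hv]
  have hmem𝓣 : ∀ y : galoisCohomology (ρ.tateDual n) 1, y ∈ 𝓣.selmerGroup ↔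
      ∀ v : HeightOneSpectrum (𝓞 K), (Sum.inr v : Place K) ∉ S₁ →
        galoisCohomology.localization (ρ.tateDual n) (Sum.inr v) 1 y ∈
          unramifiedSubgroup (GaloisRep.toLocal v (ρ.tateDual n)) 1 := by
    intro y
    rw [SelmerStructure.mem_selmerGroup_iff]
    constructor
    · intro h v hv
      have h' := h (Sum.inr v)
      rwa [h𝓣ur v hv] at h'
    · intro h v
      cases v with
      | inl w => exact AddSubgroup.mem_top _
      | inr v =>
        by_cases hv : (Sum.inr v : Place K) ∈ S₁
        · rw [h𝓣top v hv]; exact AddSubgroup.mem_top _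
        · rw [h𝓣ur v hv]; exact h v hv
  let A₁ : AddSubgroup (galoisCohomology (ρ.tateDual n) 1) := 𝓣.selmerGroup
  let β₁ : galoisCohomology (ρ.tateDual n) 1 →+ (∀ v, Bv v) :=
    AddMonoidHom.pi fun v => galoisCohomology.localization (ρ.tateDual n)
      (Sum.inr (v : HeightOneSpectrum (𝓞 K))) 1
  have hβ₁ : ∀ y (v : Sf), β₁ y v =
      galoisCohomology.localization (ρ.tateDual n) (Sum.inr (v : HeightOneSpectrum (𝓞 K))) 1 y :=
    fun _ _ => rfl
  let f₁ : A₁ →+ (β₁.comp A₁.subtype).range := (β₁.comp A₁.subtype).rangeRestrict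
  have hf₁ : Surjective f₁ := AddMonoidHom.rangeRestrict_surjective _
  have hf₁val : ∀ y : A₁, (f₁ y : ∀ v, Bv v) = β₁ y := fun y => rfl
  have hkerf₁ : f₁.ker ≤ (φ.comp A₁.subtype).ker := by
    intro y hy
    rw [AddMonoidHom.mem_ker] at hy ⊢
    have hy0 : β₁ (y : galoisCohomology (ρ.tateDual n) 1) = 0 := by
      rw [← hf₁val, hy]; rfl
    rw [AddMonoidHom.comp_apply, AddSubgroup.coe_subtype]
    refine hφ _ ((hmem𝓣 _).1 y.2) fun v hv => ?_
    have := congr_fun hy0 ⟨v, (hSf v).2 hv⟩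
    rwa [hβ₁, Pi.zero_apply] at this
  let χ : (β₁.comp A₁.subtype).range →+ ZMod n := f₁.liftOfSurjective hf₁ ⟨φ.comp A₁.subtype, hkerf₁⟩
  have hχ : ∀ y : A₁, χ (f₁ y) = φ y := fun y =>
    AddMonoidHom.liftOfRightInverse_comp_apply f₁ _ _ ⟨φ.comp A₁.subtype, hkerf₁⟩ y
  obtain ⟨t1, ht1⟩ := exists_apply_eq_of_bijective hBn bS hbSbij (β₁.comp A₁.subtype).range χ
  -- extend `t1` by zero off `Sf`
  refine ⟨fun v => if h : v ∈ Sf then t1 ⟨v, h⟩ else 0, fun y hy => ?_⟩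
  have hyA : y ∈ A₁ := (hmem𝓣 y).2 hy
  have hmem : β₁ y ∈ (β₁.comp A₁.subtype).range := ⟨⟨y, hyA⟩, rfl⟩
  have h1 := ht1 (β₁ y) hmem
  rw [hbS] at h1
  have h2 : χ ⟨β₁ y, hmem⟩ = φ y := by
    have h3 := hχ ⟨y, hyA⟩
    have h4 : f₁ ⟨y, hyA⟩ = ⟨β₁ y, hmem⟩ := Subtype.ext rfl
    rwa [h4] at h3
  rw [← h2, ← h1, ← Finset.sum_coe_sort Sf]
  refine Finset.sum_congr rfl fun v _ => ?_
  simp only [dif_pos v.2]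
  rfl

end OnS

end Literature.NumberTheory.GaloisCohomology.PoitouTateFinite.PoitouTateShaAnnihilator

end Part4

/-!
## Part 5 — port of `Summits/BirchSwinnertonDyer/BirchSwinnertonDyer/Theorems/CumulativeHeegnerLeopoldtRedSplitControlAtThreeShaDualNewPlace.lean` (2 declarations kept)

# Poitou–Tate, the annihilator of `Ш¹` — part 2/3: at a new place `v₀ ∉ S`, localisation is onto `H¹(K_{v₀}, M^D)/H¹_ur` and a functional killing the classes unramified off `S` has an UNRAMIFIED representative `t_{v₀} ∈ H¹_ur(K_{v₀}, M)` (How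

Declarations of this Part (verbatim port; each keeps its own docstring and citation): `exists_localization_sub_mem_unramifiedSubgroup`, `exists_mem_unramifiedSubgroup_localTatePairingZMod_eq`.

Reference keys (see `references.bib` and the declarations' citations): [Howard2004HeegnerKolyvagin], [MilneADT2006].
-/

section Part5

open _root_.Function _root_.NumberField _root_.IsDedekindDomain
open scoped _root_.NumberField

universe u

set_option autoImplicit false

namespace Literature.NumberTheory.GaloisCohomology.PoitouTateFinite.PoitouTateShaAnnihilator

open Literature.NumberTheory.GaloisRepresentations
open Literature.NumberTheory.GaloisRepresentations.DiscreteGaloisModule (mu localTatePairingZMod tateDual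
  unramifiedSubgroup SelmerStructure)
open Literature.NumberTheory.GaloisCohomology

/-! ## §1 Surjectivity of localisation onto `H¹(K_{v₀}, M^D)/H¹_ur` at a new place `v₀ ∉ S` -/

section NewPlace

variable {K : Type u} [Field K] [NumberField K] {M : Type u} [AddCommGroup M] [TopologicalSpace M]
  [DiscreteTopology M] [Finite M] {n : ℕ}

/-- **Every local class at a new place is a global class up to an unramified one.** Let the family
`inv` satisfy Milne I Thm. 2.6 (`UnramifiedOrthogonal`) and Poitou–Tate for Selmer structures
(`SelmerComplement`); let `S ⊇ {v ∣ ∞} ∪ {v ∣ n} ∪ Ram(M)` be finite and LARGE in the sense of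
`exists_finset_forall_localization_eq_zero` (`Ш¹_S(M) = Ш¹(M)` at the finite places); let `v₀ ∉ S` be a
finite place. Then for every `u₀ ∈ H¹(K_{v₀}, M^D)` there is a global `y ∈ H¹(K, M^D)`, unramified at
the finite places outside `S ∪ {v₀}`, with `loc_{v₀} y − u₀ ∈ H¹_ur(K_{v₀}, M^D)`: Howard's Thm. 2.1.11
(second sequence) for the Selmer structures `𝓕 = ` strict at `S ∪ {v₀}` ` ≤ 𝓖 = ` strict at `S`, both
unramified outside, whose `H¹_𝓖(K, M) = Ш¹_S(M) = Ш¹(M)` pairs to zero with everything, and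
`𝓖^*_{v₀} = H¹_ur(K_{v₀}, M)^* = H¹_ur(K_{v₀}, M^D)` (Milne I Thm. 2.6).
[cite: Howard2004HeegnerKolyvagin, Thm. 2.1.11 (arXiv:1202.6340 p. 6)] [cite: MilneADT2006, Ch. I, Thm. 2.6] -/
theorem exists_localization_sub_mem_unramifiedSubgroup {inv : LocalInvariants K n}
    (hur : inv.UnramifiedOrthogonal) (hcomp : inv.SelmerComplement)
    (ρ : DiscreteGaloisModule K M) (hM : ∀ m : M, n • m = 0)
    (S : Finset (Place K)) (hinf : ∀ w : InfinitePlace K, (Sum.inl w : Place K) ∈ S)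
    (hS : ∀ v : HeightOneSpectrum (𝓞 K), (Sum.inr v : Place K) ∉ S →
      ((n : ℕ) : 𝓞 K) ∉ v.asIdeal ∧ GaloisRep.IsUnramifiedAt v ρ)
    (hstab : ∀ x : galoisCohomology ρ 1,
      (∀ v : HeightOneSpectrum (𝓞 K), (Sum.inr v : Place K) ∈ S →
        galoisCohomology.localization ρ (Sum.inr v) 1 x = 0) →
      (∀ v : HeightOneSpectrum (𝓞 K), (Sum.inr v : Place K) ∉ S →
        galoisCohomology.localization ρ (Sum.inr v) 1 x ∈ unramifiedSubgroup (GaloisRep.toLocal v ρ) 1) →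
      ∀ v : HeightOneSpectrum (𝓞 K), galoisCohomology.localization ρ (Sum.inr v) 1 x = 0)
    {v₀ : HeightOneSpectrum (𝓞 K)} (hv₀ : (Sum.inr v₀ : Place K) ∉ S)
    (u₀ : galoisCohomology ((ρ.tateDual n).toLocal (Sum.inr v₀)) 1) :
    ∃ y : galoisCohomology (ρ.tateDual n) 1,
      (∀ v : HeightOneSpectrum (𝓞 K), (Sum.inr v : Place K) ∉ S → v ≠ v₀ →
        galoisCohomology.localization (ρ.tateDual n) (Sum.inr v) 1 y ∈
          unramifiedSubgroup (GaloisRep.toLocal v (ρ.tateDual n)) 1) ∧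
      galoisCohomology.localization (ρ.tateDual n) (Sum.inr v₀) 1 y - u₀ ∈
        unramifiedSubgroup (GaloisRep.toLocal v₀ (ρ.tateDual n)) 1 := by
  classical
  -- `S' = S ∪ {v₀}`; `𝓖` = strict at `S`, unramified outside (`𝓖_{v₀} = H¹_ur`); `𝓕` = strict at `S'`
  set S' : Finset (Place K) := insert (Sum.inr v₀) S with hS'def
  let 𝓖 : SelmerStructure ρ := SelmerStructure.ofFinite ρ fun v =>
    if (Sum.inr v : Place K) ∈ S then ⊥ else unramifiedSubgroup (GaloisRep.toLocal v ρ) 1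
  let 𝓕 : SelmerStructure ρ := SelmerStructure.ofFinite ρ fun v =>
    if (Sum.inr v : Place K) ∈ S' then ⊥ else unramifiedSubgroup (GaloisRep.toLocal v ρ) 1
  have hS'S : S ⊆ S' := Finset.subset_insert _ _
  have hv₀S' : (Sum.inr v₀ : Place K) ∈ S' := Finset.mem_insert_self _ _
  have h𝓖bot : ∀ v : HeightOneSpectrum (𝓞 K), (Sum.inr v : Place K) ∈ S → 𝓖 (Sum.inr v) = ⊥ :=
    fun v hv => by simp only [𝓖, SelmerStructure.ofFinite_inr, if_pos hv]; rfl
  have h𝓖ur : ∀ v : HeightOneSpectrum (𝓞 K), (Sum.inr v : Place K) ∉ S →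
      𝓖 (Sum.inr v) = unramifiedSubgroup (GaloisRep.toLocal v ρ) 1 :=
    fun v hv => by simp only [𝓖, SelmerStructure.ofFinite_inr, if_neg hv]
  have h𝓕bot : ∀ v : HeightOneSpectrum (𝓞 K), (Sum.inr v : Place K) ∈ S' → 𝓕 (Sum.inr v) = ⊥ :=
    fun v hv => by simp only [𝓕, SelmerStructure.ofFinite_inr, if_pos hv]; rfl
  have h𝓕ur : ∀ v : HeightOneSpectrum (𝓞 K), (Sum.inr v : Place K) ∉ S' →
      𝓕 (Sum.inr v) = unramifiedSubgroup (GaloisRep.toLocal v ρ) 1 :=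
    fun v hv => by simp only [𝓕, SelmerStructure.ofFinite_inr, if_neg hv]
  have hle : 𝓕 ≤ 𝓖 := by
    intro v
    cases v with
    | inl w => exact le_rfl
    | inr v =>
      by_cases hv : (Sum.inr v : Place K) ∈ S
      · rw [h𝓕bot v (hS'S hv), h𝓖bot v hv]
      · by_cases hv' : (Sum.inr v : Place K) ∈ S'
        · rw [h𝓕bot v hv']; exact bot_le
        · rw [h𝓕ur v hv', h𝓖ur v hv]
  have h𝓕 : 𝓕.IsUnramifiedOutside S' := ⟨fun w => hS'S (hinf w), fun v hv => h𝓕ur v hv⟩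
  have h𝓖 : 𝓖.IsUnramifiedOutside S' :=
    ⟨fun w => hS'S (hinf w), fun v hv => h𝓖ur v fun h => hv (hS'S h)⟩
  have hS'ur : ∀ v : HeightOneSpectrum (𝓞 K), (Sum.inr v : Place K) ∉ S' →
      ((n : ℕ) : 𝓞 K) ∉ v.asIdeal ∧ GaloisRep.IsUnramifiedAt v ρ :=
    fun v hv => hS v fun h => hv (hS'S h)
  -- the test family `u`, supported at `v₀`
  let u : Π v : Place K, galoisCohomology ((ρ.tateDual n).toLocal v) 1 :=
    Function.update (fun _ => 0) (Sum.inr v₀) u₀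
  have hu₀ : u (Sum.inr v₀) = u₀ := Function.update_self _ _ _
  have hu : ∀ v : Place K, v ≠ Sum.inr v₀ → u v = 0 := fun v hv => Function.update_of_ne hv _ _
  -- hypotheses of `SelmerComplement` (ii)
  have huF : ∀ v ∈ S', u v ∈ inv.dualSelmerStructure ρ 𝓕 v := by
    intro v hv
    by_cases hvv : v = Sum.inr v₀
    · subst hvv
      rw [LocalInvariants.dualSelmerStructure_apply, h𝓕bot v₀ hv₀S',
        LocalInvariants.dualLocalCondition_bot]
      exact AddSubgroup.mem_top _
    · rw [hu v hvv]
      exact AddSubgroup.zero_mem _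
  have horth : ∀ x ∈ 𝓖.selmerGroup, ∑ v ∈ S', localTatePairingZMod ρ n v (inv v)
      (galoisCohomology.localization ρ v 1 x) (u v) = 0 := by
    intro x hx
    rw [SelmerStructure.mem_selmerGroup_iff] at hx
    have hx0 : ∀ v : HeightOneSpectrum (𝓞 K), galoisCohomology.localization ρ (Sum.inr v) 1 x = 0 := by
      refine hstab x (fun v hv => ?_) (fun v hv => ?_)
      · have h := hx (Sum.inr v)
        rw [h𝓖bot v hv, AddSubgroup.mem_bot] at h
        exact h
      · have h := hx (Sum.inr v)
        rw [h𝓖ur v hv] at h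
        exact h
    refine Finset.sum_eq_zero fun v _ => ?_
    by_cases hvv : v = Sum.inr v₀
    · subst hvv
      rw [hx0 v₀, map_zero, AddMonoidHom.zero_apply]
    · rw [hu v hvv, map_zero]
  obtain ⟨y, hy, hyu⟩ := (hcomp ρ hM S' hS'ur 𝓕 𝓖 hle h𝓕 h𝓖).2 u huF horth
  refine ⟨y, fun v hv hne => ?_, ?_⟩
  · -- `y ∈ H¹_{𝓕*}(K, M^D)`: at a finite `v ∉ S'`, `𝓕_v = H¹_ur(M)` and `𝓕^*_v = H¹_ur(M^D)`
    have hvS' : (Sum.inr v : Place K) ∉ S' := by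
      rw [hS'def, Finset.mem_insert, not_or]
      exact ⟨fun h => hne (Sum.inr_injective h), hv⟩
    have h := (SelmerStructure.mem_selmerGroup_iff _ y).1 hy (Sum.inr v)
    rw [LocalInvariants.dualSelmerStructure_apply, h𝓕ur v hvS',
      (hur ρ hM v (hS'ur v hvS').1 (hS'ur v hvS').2).1] at h
    exact h
  · have h := hyu (Sum.inr v₀) hv₀S'
    rw [LocalInvariants.dualSelmerStructure_apply, hu₀, h𝓖ur v₀ hv₀,
      (hur ρ hM v₀ (hS v₀ hv₀).1 (hS v₀ hv₀).2).1] at h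
    exact h

end NewPlace

/-! ## §2 The unramified representative `t_{v₀}` at a new place -/

section Representative

variable {K : Type u} [Field K] [NumberField K] {M : Type u} [AddCommGroup M] [TopologicalSpace M]
  [DiscreteTopology M] [Finite M] {n : ℕ}

/-- **The unramified representative at a new place.**  In the situation of
`exists_localization_sub_mem_unramifiedSubgroup` (family `inv` with `IsPerfect`, `UnramifiedOrthogonal`,
`SelmerComplement`; `S` large; `v₀ ∉ S` finite), let `λ : H¹(K, M^D) → ℤ/n` be additive and vanish on every
class unramified off `S`.  Then there is an UNRAMIFIED `t₀ ∈ H¹_ur(K_{v₀}, M)` with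
`inv_{v₀}(t₀ ∪ loc_{v₀} y) = λ(y)` for every `y` unramified off `S ∪ {v₀}`: `λ` restricted to those classes
factors through `H¹(K_{v₀}, M^D)/H¹_ur` (surjectivity of localisation, and `λ` kills the classes with
unramified `v₀`-component), the induced functional on `H¹(K_{v₀}, M^D)` is `⟨t₀, ·⟩_{v₀}` by local Tate
duality, and `t₀` annihilates `H¹_ur(K_{v₀}, M^D)`, hence is unramified (Milne I Thm. 2.6).
[cite: MilneADT2006, Ch. I, Cor. 2.3, Thm. 2.6, Thm. 4.10 (proof)] -/
theorem exists_mem_unramifiedSubgroup_localTatePairingZMod_eq {inv : LocalInvariants K n}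
    (hperf : inv.IsPerfect) (hur : inv.UnramifiedOrthogonal) (hcomp : inv.SelmerComplement)
    (ρ : DiscreteGaloisModule K M) (hM : ∀ m : M, n • m = 0)
    (S : Finset (Place K)) (hinf : ∀ w : InfinitePlace K, (Sum.inl w : Place K) ∈ S)
    (hS : ∀ v : HeightOneSpectrum (𝓞 K), (Sum.inr v : Place K) ∉ S →
      ((n : ℕ) : 𝓞 K) ∉ v.asIdeal ∧ GaloisRep.IsUnramifiedAt v ρ)
    (hstab : ∀ x : galoisCohomology ρ 1,
      (∀ v : HeightOneSpectrum (𝓞 K), (Sum.inr v : Place K) ∈ S →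
        galoisCohomology.localization ρ (Sum.inr v) 1 x = 0) →
      (∀ v : HeightOneSpectrum (𝓞 K), (Sum.inr v : Place K) ∉ S →
        galoisCohomology.localization ρ (Sum.inr v) 1 x ∈ unramifiedSubgroup (GaloisRep.toLocal v ρ) 1) →
      ∀ v : HeightOneSpectrum (𝓞 K), galoisCohomology.localization ρ (Sum.inr v) 1 x = 0)
    (lam : galoisCohomology (ρ.tateDual n) 1 →+ ZMod n)
    (hlam : ∀ y : galoisCohomology (ρ.tateDual n) 1,
      (∀ v : HeightOneSpectrum (𝓞 K), (Sum.inr v : Place K) ∉ S →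
        galoisCohomology.localization (ρ.tateDual n) (Sum.inr v) 1 y ∈
          unramifiedSubgroup (GaloisRep.toLocal v (ρ.tateDual n)) 1) → lam y = 0)
    {v₀ : HeightOneSpectrum (𝓞 K)} (hv₀ : (Sum.inr v₀ : Place K) ∉ S) :
    ∃ t₀ : galoisCohomology (ρ.toLocal (Sum.inr v₀)) 1,
      t₀ ∈ unramifiedSubgroup (GaloisRep.toLocal v₀ ρ) 1 ∧
      ∀ y : galoisCohomology (ρ.tateDual n) 1,
        (∀ v : HeightOneSpectrum (𝓞 K), (Sum.inr v : Place K) ∉ S → v ≠ v₀ →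
          galoisCohomology.localization (ρ.tateDual n) (Sum.inr v) 1 y ∈
            unramifiedSubgroup (GaloisRep.toLocal v (ρ.tateDual n)) 1) →
        localTatePairingZMod ρ n (Sum.inr v₀) (inv (Sum.inr v₀)) t₀
          (galoisCohomology.localization (ρ.tateDual n) (Sum.inr v₀) 1 y) = lam y := by
  classical
  -- the classes unramified off `S ∪ {v₀}`
  let 𝓣' : SelmerStructure (ρ.tateDual n) := SelmerStructure.ofFinite (ρ.tateDual n) fun v =>
    if (Sum.inr v : Place K) ∈ S ∨ v = v₀ then ⊤
    else unramifiedSubgroup (GaloisRep.toLocal v (ρ.tateDual n)) 1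
  have h𝓣'top : ∀ v : HeightOneSpectrum (𝓞 K), ((Sum.inr v : Place K) ∈ S ∨ v = v₀) →
      𝓣' (Sum.inr v) = ⊤ :=
    fun v hv => by simp only [𝓣', SelmerStructure.ofFinite_inr, if_pos hv]; rfl
  have h𝓣'ur : ∀ v : HeightOneSpectrum (𝓞 K), ¬ ((Sum.inr v : Place K) ∈ S ∨ v = v₀) →
      𝓣' (Sum.inr v) = unramifiedSubgroup (GaloisRep.toLocal v (ρ.tateDual n)) 1 :=
    fun v hv => by simp only [𝓣', SelmerStructure.ofFinite_inr, if_neg hv]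
  have hmem𝓣' : ∀ y : galoisCohomology (ρ.tateDual n) 1, y ∈ 𝓣'.selmerGroup ↔
      ∀ v : HeightOneSpectrum (𝓞 K), (Sum.inr v : Place K) ∉ S → v ≠ v₀ →
        galoisCohomology.localization (ρ.tateDual n) (Sum.inr v) 1 y ∈
          unramifiedSubgroup (GaloisRep.toLocal v (ρ.tateDual n)) 1 := by
    intro y
    rw [SelmerStructure.mem_selmerGroup_iff]
    constructor
    · intro h v hv hne
      have h' := h (Sum.inr v)
      rwa [h𝓣'ur v (not_or.2 ⟨hv, hne⟩)] at h'
    · intro h v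
      cases v with
      | inl w => exact AddSubgroup.mem_top _
      | inr v =>
        by_cases hv : (Sum.inr v : Place K) ∈ S ∨ v = v₀
        · rw [h𝓣'top v hv]; exact AddSubgroup.mem_top _
        · rw [h𝓣'ur v hv]; exact h v (fun h' => hv (Or.inl h')) (fun h' => hv (Or.inr h'))
  let A' : AddSubgroup (galoisCohomology (ρ.tateDual n) 1) := 𝓣'.selmerGroup
  let U : AddSubgroup (galoisCohomology ((ρ.tateDual n).toLocal (Sum.inr v₀)) 1) :=
    unramifiedSubgroup (GaloisRep.toLocal v₀ (ρ.tateDual n)) 1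
  let g : A' →+ galoisCohomology ((ρ.tateDual n).toLocal (Sum.inr v₀)) 1 ⧸ U :=
    (QuotientAddGroup.mk' U).comp
      ((galoisCohomology.localization (ρ.tateDual n) (Sum.inr v₀) 1).comp A'.subtype)
  have hg_apply : ∀ y : A', g y = QuotientAddGroup.mk' U
      (galoisCohomology.localization (ρ.tateDual n) (Sum.inr v₀) 1 y) := fun _ => rfl
  -- surjectivity of `g` (§1)
  have hg : Surjective g := by
    intro q
    obtain ⟨u₀, rfl⟩ := QuotientAddGroup.mk'_surjective U q
    obtain ⟨y, hy, hyu⟩ := exists_localization_sub_mem_unramifiedSubgroup hur hcomp ρ hM S hinf hS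
      hstab hv₀ u₀
    refine ⟨⟨y, (hmem𝓣' y).2 hy⟩, ?_⟩
    rw [hg_apply, QuotientAddGroup.mk'_apply, QuotientAddGroup.mk'_apply, QuotientAddGroup.eq_iff_sub_mem]
    exact hyu
  -- `λ` kills `ker g` (those classes are unramified off `S`)
  have hkerg : g.ker ≤ (lam.comp A'.subtype).ker := by
    intro y hy
    rw [AddMonoidHom.mem_ker, hg_apply, QuotientAddGroup.mk'_apply, QuotientAddGroup.eq_zero_iff] at hy
    rw [AddMonoidHom.mem_ker, AddMonoidHom.comp_apply, AddSubgroup.coe_subtype]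
    refine hlam _ fun v hv => ?_
    by_cases hvv : v = v₀
    · subst hvv; exact hy
    · exact (hmem𝓣' _).1 y.2 v hv hvv
  let Λq : galoisCohomology ((ρ.tateDual n).toLocal (Sum.inr v₀)) 1 ⧸ U →+ ZMod n :=
    g.liftOfSurjective hg ⟨lam.comp A'.subtype, hkerg⟩
  have hΛq : ∀ y : A', Λq (g y) = lam y := fun y =>
    AddMonoidHom.liftOfRightInverse_comp_apply g _ _ ⟨lam.comp A'.subtype, hkerg⟩ y
  let Λ : galoisCohomology ((ρ.tateDual n).toLocal (Sum.inr v₀)) 1 →+ ZMod n :=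
    Λq.comp (QuotientAddGroup.mk' U)
  -- local Tate duality at `v₀`: `Λ = ⟨t₀, ·⟩_{v₀}`
  obtain ⟨t₀, ht₀⟩ := ((hperf v₀).2 ρ hM).1.2 Λ
  refine ⟨t₀, ?_, fun y hy => ?_⟩
  · -- `t₀` annihilates `H¹_ur(K_{v₀}, M^D)`, hence is unramified (Milne I Thm. 2.6)
    refine (hur ρ hM v₀ (hS v₀ hv₀).1 (hS v₀ hv₀).2).2 t₀ fun b hb => ?_
    rw [ht₀]
    have hb0 : (QuotientAddGroup.mk' U) b = 0 := (QuotientAddGroup.eq_zero_iff _).mpr hb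
    change Λq (QuotientAddGroup.mk' U b) = 0
    rw [hb0, map_zero]
  · have hyA' : y ∈ A' := (hmem𝓣' y).2 hy
    rw [ht₀, ← hΛq ⟨y, hyA'⟩]
    rfl

end Representative

end Literature.NumberTheory.GaloisCohomology.PoitouTateFinite.PoitouTateShaAnnihilator

end Part5

/-!
## Part 6 — port of `Summits/BirchSwinnertonDyer/BirchSwinnertonDyer/Theorems/CumulativeHeegnerLeopoldtRedSplitControlAtThreeShaDualAnnihilator.lean` (1 declarations kept)

# Poitou–Tate: the annihilator of `Ш¹(K, M^D)` in `H¹(K, M^D)^*` is the image of `γ¹` (the algebraic half of Milne I Thm. 4.10 (a) `Ш²(K, M) ≅ Ш¹(K, M^D)^*`, from Thm. 4.10 (b) for Selmer structures)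

Declarations of this Part (verbatim port; each keeps its own docstring and citation): `exists_family_sum_localTatePairing_eq`.

Reference keys (see `references.bib` and the declarations' citations): [MilneADT2006], [Howard2004HeegnerKolyvagin].
-/

section Part6

open _root_.Function _root_.NumberField _root_.IsDedekindDomain
open scoped _root_.NumberField

universe u

set_option autoImplicit false

namespace Literature.NumberTheory.GaloisCohomology.PoitouTateFinite.PoitouTateShaAnnihilator

open Literature.NumberTheory.GaloisRepresentations
open Literature.NumberTheory.GaloisRepresentations.DiscreteGaloisModule (mu localTatePairingZMod tateDual
  unramifiedSubgroup SelmerStructure)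
open Literature.NumberTheory.GaloisCohomology

section Main

variable {K : Type u} [Field K] [NumberField K] {M : Type u} [AddCommGroup M] [TopologicalSpace M]
  [DiscreteTopology M] [Finite M] {n : ℕ} [NeZero n]

/-- **The annihilator of `Ш¹` lies in the image of `γ¹` (Milne I Thm. 4.10: the step (b) ⟹ (a)).**  Let
`inv` be a family of local invariant maps with `IsPerfect` (local Tate duality at the finite places),
`UnramifiedOrthogonal` (Milne I Thm. 2.6) and `SelmerComplement` (Howard Thm. 2.1.11); `M` a finite discrete
`Γ_K`-module killed by `n ≥ 1`, unramified outside the finite set of places `S₀ ⊇ {v ∣ ∞} ∪ {v ∣ n}`; and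
`φ : H¹(K, M^D) →+ ℤ/n` an additive map vanishing on every class that is locally zero at ALL FINITE places.
Then there are a finite `S₁ ⊇ S₀` and a family `t_v ∈ H¹(K_v, M)` (`v` over all places), zero at the infinite
places and unramified at the finite places outside `S₁`, such that for every `y ∈ H¹(K, M^D)` and every
finite `S ⊇ S₁` outside which `y` is unramified, `φ(y) = ∑_{v ∈ S} inv_v (t_v ∪ loc_v y)`.
[cite: MilneADT2006, Ch. I, Thm. 4.10 (a)(b) and proof, Lemma 4.8, Cor. 2.3, Thm. 2.6]
[cite: Howard2004HeegnerKolyvagin, Thm. 2.1.11 (arXiv:1202.6340 p. 6)] -/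
theorem exists_family_sum_localTatePairing_eq {inv : LocalInvariants K n} (hperf : inv.IsPerfect)
    (hur : inv.UnramifiedOrthogonal) (hcomp : inv.SelmerComplement)
    (ρ : DiscreteGaloisModule K M) (hM : ∀ m : M, n • m = 0)
    (S₀ : Finset (Place K)) (hinf : ∀ w : InfinitePlace K, (Sum.inl w : Place K) ∈ S₀)
    (hS₀ : ∀ v : HeightOneSpectrum (𝓞 K), (Sum.inr v : Place K) ∉ S₀ →
      ((n : ℕ) : 𝓞 K) ∉ v.asIdeal ∧ GaloisRep.IsUnramifiedAt v ρ)
    (φ : galoisCohomology (ρ.tateDual n) 1 →+ ZMod n)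
    (hφ : ∀ y : galoisCohomology (ρ.tateDual n) 1,
      (∀ v : HeightOneSpectrum (𝓞 K),
        galoisCohomology.localization (ρ.tateDual n) (Sum.inr v) 1 y = 0) → φ y = 0) :
    ∃ (S₁ : Finset (Place K)) (t : Π v : Place K, galoisCohomology (ρ.toLocal v) 1),
      S₀ ⊆ S₁ ∧ (∀ w : InfinitePlace K, t (Sum.inl w) = 0) ∧
      (∀ v : HeightOneSpectrum (𝓞 K), (Sum.inr v : Place K) ∉ S₁ →
        t (Sum.inr v) ∈ unramifiedSubgroup (GaloisRep.toLocal v ρ) 1) ∧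
      ∀ (y : galoisCohomology (ρ.tateDual n) 1) (S : Finset (Place K)), S₁ ⊆ S →
        (∀ v : HeightOneSpectrum (𝓞 K), (Sum.inr v : Place K) ∉ S →
          galoisCohomology.localization (ρ.tateDual n) (Sum.inr v) 1 y ∈
            unramifiedSubgroup (GaloisRep.toLocal v (ρ.tateDual n)) 1) →
        φ y = ∑ v ∈ S, localTatePairingZMod ρ n v (inv v) (t v)
          (galoisCohomology.localization (ρ.tateDual n) v 1 y) := by
  classical
  haveI : Finite (DiscreteGaloisModule.TateDual K M n) := DiscreteGaloisModule.TateDual.finite K M n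
  /- Step 1: enlarge `S₀` to `S₁` so that `Ш¹_{S₁}(M) = Ш¹(M)` and `Ш¹_{S₁}(M^D) = Ш¹(M^D)` at the
  finite places. -/
  obtain ⟨SM, hSM₀, hstabM⟩ :=
    exists_finset_forall_localization_eq_zero ρ S₀ hinf fun v hv => (hS₀ v hv).2
  obtain ⟨SN, hSN₀, hstabN⟩ :=
    exists_finset_forall_localization_eq_zero (ρ.tateDual n) S₀ hinf fun v hv =>
      PoitouTateReduction.isUnramifiedAt_tateDual ρ v (hS₀ v hv).1 (hS₀ v hv).2
  set S₁ : Finset (Place K) := SM ∪ SN with hS₁def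
  have hS₀S₁ : S₀ ⊆ S₁ := hSM₀.trans Finset.subset_union_left
  have hinf₁ : ∀ w : InfinitePlace K, (Sum.inl w : Place K) ∈ S₁ := fun w => hS₀S₁ (hinf w)
  have hS₁ : ∀ v : HeightOneSpectrum (𝓞 K), (Sum.inr v : Place K) ∉ S₁ →
      ((n : ℕ) : 𝓞 K) ∉ v.asIdeal ∧ GaloisRep.IsUnramifiedAt v ρ :=
    fun v hv => hS₀ v fun h => hv (hS₀S₁ h)
  have hstabM₁ : ∀ x : galoisCohomology ρ 1,
      (∀ v : HeightOneSpectrum (𝓞 K), (Sum.inr v : Place K) ∈ S₁ →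
        galoisCohomology.localization ρ (Sum.inr v) 1 x = 0) →
      (∀ v : HeightOneSpectrum (𝓞 K), (Sum.inr v : Place K) ∉ S₁ →
        galoisCohomology.localization ρ (Sum.inr v) 1 x ∈ unramifiedSubgroup (GaloisRep.toLocal v ρ) 1) →
      ∀ v : HeightOneSpectrum (𝓞 K), galoisCohomology.localization ρ (Sum.inr v) 1 x = 0 := by
    intro x h0 hu
    refine hstabM x (fun v hv => h0 v (Finset.subset_union_left hv)) fun v hv => ?_
    by_cases hv₁ : (Sum.inr v : Place K) ∈ S₁
    · rw [h0 v hv₁]; exact AddSubgroup.zero_mem _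
    · exact hu v hv₁
  have hstabN₁ : ∀ y : galoisCohomology (ρ.tateDual n) 1,
      (∀ v : HeightOneSpectrum (𝓞 K), (Sum.inr v : Place K) ∈ S₁ →
        galoisCohomology.localization (ρ.tateDual n) (Sum.inr v) 1 y = 0) →
      (∀ v : HeightOneSpectrum (𝓞 K), (Sum.inr v : Place K) ∉ S₁ →
        galoisCohomology.localization (ρ.tateDual n) (Sum.inr v) 1 y ∈
          unramifiedSubgroup (GaloisRep.toLocal v (ρ.tateDual n)) 1) →
      ∀ v : HeightOneSpectrum (𝓞 K), galoisCohomology.localization (ρ.tateDual n) (Sum.inr v) 1 y = 0 := by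
    intro y h0 hu
    refine hstabN y (fun v hv => h0 v (Finset.subset_union_right hv)) fun v hv => ?_
    by_cases hv₁ : (Sum.inr v : Place K) ∈ S₁
    · rw [h0 v hv₁]; exact AddSubgroup.zero_mem _
    · exact hu v hv₁
  /- Step 2: on `S₁`, `φ` is `∑_{v ∈ S₁,f} ⟨t¹_v, ·⟩` on the classes unramified off `S₁`. -/
  set Sf : Finset (HeightOneSpectrum (𝓞 K)) := S₁.preimage Sum.inr Sum.inr_injective.injOn with hSfdef
  have hSf : ∀ v : HeightOneSpectrum (𝓞 K), v ∈ Sf ↔ (Sum.inr v : Place K) ∈ S₁ := fun v =>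
    Finset.mem_preimage
  obtain ⟨t1, ht1⟩ := exists_sum_localTatePairingZMod_eq_of_unramifiedOutside hperf ρ hM S₁ φ
    fun y hyur hy0 => hφ y (hstabN₁ y hy0 hyur)
  /- Step 3: off `S₁`, the unramified representatives `t₀ v` of `λ = φ − ∑_{S₁,f} ⟨t¹_v, ·⟩`. -/
  let lam : galoisCohomology (ρ.tateDual n) 1 →+ ZMod n :=
    φ - ∑ v ∈ Sf, (localTatePairingZMod ρ n (Sum.inr v) (inv (Sum.inr v)) (t1 v)).comp
      (galoisCohomology.localization (ρ.tateDual n) (Sum.inr v) 1)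
  have hlam : ∀ y, lam y = φ y - ∑ v ∈ Sf, localTatePairingZMod ρ n (Sum.inr v) (inv (Sum.inr v)) (t1 v)
      (galoisCohomology.localization (ρ.tateDual n) (Sum.inr v) 1 y) := by
    intro y
    simp only [lam, AddMonoidHom.sub_apply, AddMonoidHom.finsetSum_apply, AddMonoidHom.comp_apply]
  have hlam0 : ∀ y : galoisCohomology (ρ.tateDual n) 1,
      (∀ v : HeightOneSpectrum (𝓞 K), (Sum.inr v : Place K) ∉ S₁ →
        galoisCohomology.localization (ρ.tateDual n) (Sum.inr v) 1 y ∈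
          unramifiedSubgroup (GaloisRep.toLocal v (ρ.tateDual n)) 1) → lam y = 0 :=
    fun y hy => by rw [hlam, ← ht1 y hy, sub_self]
  have step3 := fun (v₀ : HeightOneSpectrum (𝓞 K)) (hv₀ : (Sum.inr v₀ : Place K) ∉ S₁) =>
    exists_mem_unramifiedSubgroup_localTatePairingZMod_eq hperf hur hcomp ρ hM S₁ hinf₁ hS₁ hstabM₁ lam
      hlam0 hv₀
  choose t₀ ht₀ur ht₀eq using step3
  -- the family `t`
  let t : Π v : Place K, galoisCohomology (ρ.toLocal v) 1 := fun v =>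
    match v with
    | Sum.inl _ => 0
    | Sum.inr v' => if h : (Sum.inr v' : Place K) ∈ S₁ then t1 v' else t₀ v' h
  have ht_inl : ∀ w : InfinitePlace K, t (Sum.inl w) = 0 := fun _ => rfl
  have ht_in : ∀ v : HeightOneSpectrum (𝓞 K), (Sum.inr v : Place K) ∈ S₁ → t (Sum.inr v) = t1 v :=
    fun v h => by simp only [t, dif_pos h]
  have ht_out : ∀ (v : HeightOneSpectrum (𝓞 K)) (h : (Sum.inr v : Place K) ∉ S₁), t (Sum.inr v) = t₀ v h :=
    fun v h => by simp only [t, dif_neg h]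
  /- Step 4: the formula, by induction on the finite set `D` of places outside `S₁` where `y` may
  ramify. -/
  have hPur : ∀ (v : HeightOneSpectrum (𝓞 K)) (h : (Sum.inr v : Place K) ∉ S₁)
      (b : galoisCohomology ((ρ.tateDual n).toLocal (Sum.inr v)) 1),
      b ∈ unramifiedSubgroup (GaloisRep.toLocal v (ρ.tateDual n)) 1 →
      localTatePairingZMod ρ n (Sum.inr v) (inv (Sum.inr v)) (t (Sum.inr v)) b = 0 := by
    intro v h b hb
    have hb' : b ∈ inv.dualLocalCondition ρ (Sum.inr v) (unramifiedSubgroup (GaloisRep.toLocal v ρ) 1) := by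
      rw [(hur ρ hM v (hS₁ v h).1 (hS₁ v h).2).1]
      exact hb
    rw [LocalInvariants.mem_dualLocalCondition_iff] at hb'
    rw [ht_out v h]
    exact hb' _ (ht₀ur v h)
  have key : ∀ D : Finset (HeightOneSpectrum (𝓞 K)), (∀ v ∈ D, (Sum.inr v : Place K) ∉ S₁) →
      ∀ y : galoisCohomology (ρ.tateDual n) 1,
        (∀ v : HeightOneSpectrum (𝓞 K), (Sum.inr v : Place K) ∉ S₁ → v ∉ D →
          galoisCohomology.localization (ρ.tateDual n) (Sum.inr v) 1 y ∈
            unramifiedSubgroup (GaloisRep.toLocal v (ρ.tateDual n)) 1) →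
        φ y = (∑ v ∈ Sf, localTatePairingZMod ρ n (Sum.inr v) (inv (Sum.inr v)) (t1 v)
            (galoisCohomology.localization (ρ.tateDual n) (Sum.inr v) 1 y)) +
          ∑ v ∈ D, localTatePairingZMod ρ n (Sum.inr v) (inv (Sum.inr v)) (t (Sum.inr v))
            (galoisCohomology.localization (ρ.tateDual n) (Sum.inr v) 1 y) := by
    intro D
    induction D using Finset.induction_on with
    | empty =>
      intro _ y hy
      rw [Finset.sum_empty, add_zero, ht1 y fun v hv => hy v hv (Finset.notMem_empty v)]
    | @insert v₀ D' hv₀D' ih =>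
      intro hD y hy
      have hv₀ : (Sum.inr v₀ : Place K) ∉ S₁ := hD v₀ (Finset.mem_insert_self _ _)
      have hD' : ∀ v ∈ D', (Sum.inr v : Place K) ∉ S₁ := fun v hv => hD v (Finset.mem_insert_of_mem hv)
      -- peel off the place `v₀`
      obtain ⟨z, hz, hzy⟩ := exists_localization_sub_mem_unramifiedSubgroup hur hcomp ρ hM S₁ hinf₁ hS₁
        hstabM₁ hv₀ (galoisCohomology.localization (ρ.tateDual n) (Sum.inr v₀) 1 y)
      have hy' : ∀ v : HeightOneSpectrum (𝓞 K), (Sum.inr v : Place K) ∉ S₁ → v ∉ D' →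
          galoisCohomology.localization (ρ.tateDual n) (Sum.inr v) 1 (y - z) ∈
            unramifiedSubgroup (GaloisRep.toLocal v (ρ.tateDual n)) 1 := by
        intro v hv hvD'
        rw [map_sub]
        by_cases hvv : v = v₀
        · subst hvv
          rw [← neg_sub]
          exact AddSubgroup.neg_mem _ hzy
        · exact AddSubgroup.sub_mem _ (hy v hv (by rw [Finset.mem_insert, not_or]; exact ⟨hvv, hvD'⟩))
            (hz v hv hvv)
      have e1 := ih hD' (y - z) hy'
      have e2 : localTatePairingZMod ρ n (Sum.inr v₀) (inv (Sum.inr v₀)) (t (Sum.inr v₀))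
          (galoisCohomology.localization (ρ.tateDual n) (Sum.inr v₀) 1 z) = lam z := by
        rw [ht_out v₀ hv₀]; exact ht₀eq v₀ hv₀ z hz
      rw [hlam] at e2
      -- the pairings against `z` at the places of `D'` vanish, and at `v₀` `z` may be replaced by `y`
      have e3 : ∀ v ∈ D', localTatePairingZMod ρ n (Sum.inr v) (inv (Sum.inr v)) (t (Sum.inr v))
          (galoisCohomology.localization (ρ.tateDual n) (Sum.inr v) 1 z) = 0 := fun v hv =>
        hPur v (hD' v hv) _ (hz v (hD' v hv) fun h => hv₀D' (h ▸ hv))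
      have e4 : localTatePairingZMod ρ n (Sum.inr v₀) (inv (Sum.inr v₀)) (t (Sum.inr v₀))
          (galoisCohomology.localization (ρ.tateDual n) (Sum.inr v₀) 1 (y - z)) = 0 := by
        refine hPur v₀ hv₀ _ ?_
        rw [map_sub, ← neg_sub]
        exact AddSubgroup.neg_mem _ hzy
      rw [Finset.sum_insert hv₀D']
      have e5 : φ y = φ (y - z) + φ z := by rw [← map_add, sub_add_cancel]
      rw [e5, e1]
      simp only [map_sub, Finset.sum_sub_distrib] at e2 e4 ⊢
      have e6 : ∑ v ∈ D', localTatePairingZMod ρ n (Sum.inr v) (inv (Sum.inr v)) (t (Sum.inr v))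
          (galoisCohomology.localization (ρ.tateDual n) (Sum.inr v) 1 z) = 0 :=
        Finset.sum_eq_zero e3
      linear_combination -e2 - e4 - e6
  /- Assembly: read the formula on an arbitrary finite `S ⊇ S₁`. -/
  refine ⟨S₁, t, hS₀S₁, ht_inl, fun v hv => by rw [ht_out v hv]; exact ht₀ur v hv, fun y S hS₁S hy => ?_⟩
  let D : Finset (HeightOneSpectrum (𝓞 K)) := (S \ S₁).preimage Sum.inr Sum.inr_injective.injOn
  have hD : ∀ v ∈ D, (Sum.inr v : Place K) ∉ S₁ := fun v hv =>
    (Finset.mem_sdiff.1 (Finset.mem_preimage.1 hv)).2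
  have hyD : ∀ v : HeightOneSpectrum (𝓞 K), (Sum.inr v : Place K) ∉ S₁ → v ∉ D →
      galoisCohomology.localization (ρ.tateDual n) (Sum.inr v) 1 y ∈
        unramifiedSubgroup (GaloisRep.toLocal v (ρ.tateDual n)) 1 := by
    intro v hv hvD
    refine hy v fun hvS => hvD ?_
    exact Finset.mem_preimage.2 (Finset.mem_sdiff.2 ⟨hvS, hv⟩)
  rw [key D hD y hyD]
  -- split `∑_{v ∈ S}` as `∑_{v ∈ S₁} + ∑_{v ∈ S ∖ S₁}` and drop the infinite places (`t = 0` there)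
  set F : Place K → ZMod n := fun v => localTatePairingZMod ρ n v (inv v) (t v)
    (galoisCohomology.localization (ρ.tateDual n) v 1 y) with hF
  have hFinl : ∀ x ∈ S, x ∉ Set.range (Sum.inr : HeightOneSpectrum (𝓞 K) → Place K) → F x = 0 := by
    intro x _ hx
    cases x with
    | inl w => simp only [hF, ht_inl, map_zero, AddMonoidHom.zero_apply]
    | inr v => exact absurd ⟨v, rfl⟩ hx
  have h1 : ∑ v ∈ S₁, F v = ∑ v ∈ Sf, localTatePairingZMod ρ n (Sum.inr v) (inv (Sum.inr v)) (t1 v)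
      (galoisCohomology.localization (ρ.tateDual n) (Sum.inr v) 1 y) := by
    rw [← Finset.sum_preimage Sum.inr S₁ Sum.inr_injective.injOn F
      (fun x hx hx' => hFinl x (hS₁S hx) hx')]
    refine Finset.sum_congr rfl fun v hv => ?_
    simp only [hF, ht_in v ((hSf v).1 hv)]
  have h2 : ∑ v ∈ S \ S₁, F v = ∑ v ∈ D, localTatePairingZMod ρ n (Sum.inr v) (inv (Sum.inr v))
      (t (Sum.inr v)) (galoisCohomology.localization (ρ.tateDual n) (Sum.inr v) 1 y) := by
    rw [← Finset.sum_preimage Sum.inr (S \ S₁) Sum.inr_injective.injOn F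
      (fun x hx hx' => hFinl x (Finset.mem_sdiff.1 hx).1 hx')]
  rw [← Finset.sum_sdiff hS₁S, h1, h2, add_comm]

end Main

end Literature.NumberTheory.GaloisCohomology.PoitouTateFinite.PoitouTateShaAnnihilator

end Part6

/-!
## Part 7 — port of `Summits/BirchSwinnertonDyer/BirchSwinnertonDyer/Theorems/CumulativeHeegnerLeopoldtRedSplitControlAtThreeShaDualPerfectOfReadout.lean` (1 declarations kept)

# Poitou–Tate, the annihilator of `Ш¹` — the PERFECT PAIRING `Ш²(K, M) × Ш¹(K, M^D) → ℤ/n` (the conclusion of `poitouTate_sha_tateDual` at one module) from a readout of `Ш²` into `Hom(H¹(K, M^D), ℤ/n)` that is additive, injective AND SURJECTI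

Declarations of this Part (verbatim port; each keeps its own docstring and citation): `exists_addMonoidHom_extend_of_nsmul_eq_zero`.

Reference keys (see `references.bib` and the declarations' citations): [Lam1999].
-/

section Part7

open _root_.Function _root_.NumberField _root_.IsDedekindDomain
open scoped _root_.NumberField

universe u

set_option autoImplicit false

namespace Literature.NumberTheory.GaloisCohomology.PoitouTateFinite.PoitouTateShaAnnihilator

open Literature.NumberTheory.GaloisRepresentations
open Literature.NumberTheory.GaloisRepresentations.DiscreteGaloisModule (mu localTatePairingZMod tateDual unramifiedSubgroup SelmerStructure sha)
open Literature.NumberTheory.GaloisCohomology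

section Extend

/-- **Characters of a subgroup extend** (`ℤ/n` is self-injective, Lam §15; Baer's criterion): for an abelian
group `A` with `n • A = 0`, a subgroup `B ≤ A` and an additive `χ : B → ℤ/n`, there is an additive `φ : A → ℤ/n`
with `φ|_B = χ`. [cite: Lam1999, §15 and §3B Thm. 3.7] -/
theorem exists_addMonoidHom_extend_of_nsmul_eq_zero {A : Type*} [AddCommGroup A] {n : ℕ} [NeZero n]
    (hA : ∀ a : A, n • a = 0) (B : AddSubgroup A) (χ : B →+ ZMod n) :
    ∃ φ : A →+ ZMod n, ∀ b : B, φ b = χ b := by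
  have hB : ∀ b : B, n • b = 0 := fun b => Subtype.ext (by rw [AddSubgroup.coe_nsmul, hA, AddSubgroup.coe_zero])
  letI : Module (ZMod n) A := AddCommGroup.zmodModule hA
  letI : Module (ZMod n) B := AddCommGroup.zmodModule hB
  obtain ⟨g, hg⟩ := (Literature.AlgebraicTopology.SingularHomology.ZMod.baer_self n).extension_property (B.subtype.toZModLinearMap n)
    (fun x y h => Subtype.ext h) (χ.toZModLinearMap n)
  refine ⟨g.toAddMonoidHom, fun b => ?_⟩
  have := LinearMap.congr_fun hg b
  simpa using this

end Extend

end Literature.NumberTheory.GaloisCohomology.PoitouTateFinite.PoitouTateShaAnnihilator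

end Part7

/-!
## Part 8 — port of `Summits/BirchSwinnertonDyer/BirchSwinnertonDyer/Theorems/CumulativeHeegnerLeopoldtRedSplitControlAtThreeShaTwoReadoutRoad.lean` (2 declarations kept)

# Poitou–Tate, degree two: the PERFECT PAIRING `Ш²(K, M) × Ш¹(K, M^D) → ℤ/n` (the conclusion of `poitouTate_sha_tateDual` at one module) from the presentation road PLUS a degree-`2` OBSTRUCTION MAP `Ψ : Hom_{C_Γ}(N₁, C

Declarations of this Part (verbatim port; each keeps its own docstring and citation): `exists_zmodToQmodZ_eq_of_nsmul_eq_zero`, `exists_addMonoidHom_zmodToQmodZ_eq`.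

Reference keys (see `references.bib` and the declarations' citations): [MilneADT2006].
-/

section Part8

open _root_.Function _root_.NumberField _root_.IsDedekindDomain _root_.CategoryTheory CategoryTheory.Abelian
open scoped _root_.NumberField

set_option autoImplicit false

namespace Literature.NumberTheory.GaloisCohomology.PoitouTateFinite.PoitouTateShaTwoReadout

open _root_.Field
open Literature.NumberTheory.GaloisRepresentations Literature.NumberTheory.GaloisCohomology
open Literature.NumberTheory.GaloisRepresentations.DiscreteGaloisModule (TateDual tateDual localTatePairingZMod unramifiedSubgroup sha)
open Literature.Algebra.Homology Literature.Algebra.Homology.DiscreteRep Literature.Algebra.Homology.ExtPresentation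
open Literature.NumberTheory.GaloisRepresentations.IdeleClassBar (classBarD)
open Literature.AnabelianGeometry.AbsoluteAnabelian.Prop121vii (zmodToQmodZ zmodToQmodZ_injective)
open Literature.NumberTheory.GaloisCohomology.PoitouTateFinite.KolyvaginRoadThreePT
  (exists_finset_localization_mem_unramifiedSubgroup)

section ZMod

variable {n : ℕ} [NeZero n]

/-- **`(ℚ/ℤ)[n] = (1/n)ℤ/ℤ`**: an `n`-torsion element of `ℚ/ℤ` is `k/n` for some `k ∈ ℤ/n`. [cite: MilneADT2006, Ch. I §0 (notations: A^* = Hom(A, ℚ/ℤ), n-torsion)] -/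
theorem exists_zmodToQmodZ_eq_of_nsmul_eq_zero (q : AddCircle (1 : ℚ)) (hq : n • q = 0) :
    ∃ z : ZMod n, zmodToQmodZ n z = q := by
  obtain ⟨r, rfl⟩ := QuotientAddGroup.mk_surjective q
  change n • ((r : ℚ) : AddCircle (1 : ℚ)) = 0 at hq
  rw [← AddCircle.coe_nsmul, AddCircle.coe_eq_zero_iff] at hq
  obtain ⟨m, hm⟩ := hq
  rw [zsmul_eq_mul, mul_one, nsmul_eq_mul] at hm
  have hn : (n : ℚ) ≠ 0 := Nat.cast_ne_zero.2 (NeZero.ne n)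
  refine ⟨(m : ZMod n), ?_⟩
  rw [zmodToQmodZ, ZMod.lift_coe]
  change ((((m : ℚ)) / n : ℚ) : AddCircle (1 : ℚ)) = ((r : ℚ) : AddCircle (1 : ℚ))
  rw [hm, mul_div_cancel_left₀ r hn]

/-- **An additive map `E : A → ℚ/ℤ` on an `n`-torsion group `A` factors through `ℤ/n ↪ ℚ/ℤ`**: there is an additive
`φ : A → ℤ/n` with `E a = φ(a)/n`. [cite: MilneADT2006, Ch. I §0 (notations: A^* = Hom(A, ℚ/ℤ), n-torsion)] -/
theorem exists_addMonoidHom_zmodToQmodZ_eq {A : Type*} [AddCommGroup A] (hA : ∀ a : A, n • a = 0)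
    (E : A →+ AddCircle (1 : ℚ)) : ∃ φ : A →+ ZMod n, ∀ a : A, zmodToQmodZ n (φ a) = E a := by
  have h : ∀ a : A, ∃ z : ZMod n, zmodToQmodZ n z = E a := fun a =>
    exists_zmodToQmodZ_eq_of_nsmul_eq_zero (E a) (by rw [← map_nsmul, hA, map_zero])
  choose φ hφ using h
  refine ⟨{ toFun := φ, map_zero' := ?_, map_add' := ?_ }, fun a => hφ a⟩
  · apply zmodToQmodZ_injective n
    rw [hφ, map_zero, map_zero]
  · intro a b
    apply zmodToQmodZ_injective n
    rw [hφ, map_add, map_add, hφ, hφ]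

end ZMod

end Literature.NumberTheory.GaloisCohomology.PoitouTateFinite.PoitouTateShaTwoReadout

end Part8

/-!
## Part 9 — port of `Summits/BirchSwinnertonDyer/BirchSwinnertonDyer/Theorems/CumulativeHeegnerLeopoldtRedSplitControlAtThreeShaTwoReadoutRoadPresentation.lean` (1 declarations kept)

# Poitou–Tate, degree two: the `Ш²`-readout road RUN on the canonical presentation — `hα` (Tate duality for `(Γ_K, C̄)`) and (∂) (`Ext¹(ℤ[Gal(E₀/K)]ᵐ, C̄) = 0`) DISCHARGED

Declarations of this Part (verbatim port; each keeps its own docstring and citation): `ext_presLattice_classBarD_eq_zero`.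

Reference keys (see `references.bib` and the declarations' citations): [CasselsFrohlichANT1967], [MilneADT2006].
-/

section Part9

open _root_.Function _root_.NumberField _root_.IsDedekindDomain _root_.CategoryTheory CategoryTheory.Abelian
open scoped _root_.NumberField

set_option autoImplicit false

namespace Literature.NumberTheory.GaloisCohomology.PoitouTateFinite.PoitouTateShaTwoReadout

open _root_.Field
open Literature.NumberTheory.GaloisRepresentations Literature.NumberTheory.GaloisCohomology
open Literature.NumberTheory.GaloisRepresentations.DiscreteGaloisModule (TateDual tateDual localTatePairingZMod unramifiedSubgroup sha)
open Literature.Algebra.Homology Literature.Algebra.Homology.DiscreteRep Literature.Algebra.Homology.ExtPresentation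
open Literature.NumberTheory.GaloisRepresentations.IdeleClassBar (classBarD)
open Literature.AnabelianGeometry.AbsoluteAnabelian.Prop121vii (zmodToQmodZ)

section Instantiated

variable {K : Type} [Field K] [NumberField K]

open Literature.NumberTheory.GaloisRepresentations.FreePresentation (presentationComplex presentationComplex_shortExact
  presLattice presentationLayer presentationRank ext_presLattice_eq_zero)
open Literature.NumberTheory.GaloisRepresentations.HomDual (IdeleProjection readout)
open Literature.NumberTheory.GaloisRepresentations.IdeleClassBar (GalLayer)

/-- **`Ext¹_{C_Γ}(Inf ℤ[Γ/U_{E₀}]ᵐ, C̄) = 0`** (`C̄ = lim→ C_E` = door-c5's `classBarD K`): axiom I of the idèle class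
formation, `H¹(Gal(E/E₀), C_E) = 0` at every layer `E ⊇ E₀` (`IdeleClassGroup.isZero_H1_res_galoisRep`), through
door-c6's `FreePresentation.ext_presLattice_eq_zero`.  Gives the surjectivity of the boundary
`∂ : Hom(N₁, C̄) → Ext¹(N, C̄)` for door-c4's free presentation (`ExtPresentation.boundary_surjective`).
[cite: CasselsFrohlichANT1967, Ch. VII §9 Thm. 9.1][cite: MilneADT2006, I Lemma 4.13 (proof)] -/
theorem ext_presLattice_classBarD_eq_zero (E₀ : GalLayer K) (m : ℕ)
    (x : Abelian.Ext (presLattice E₀ m) (classBarD K) 1) : x = 0 :=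
  ext_presLattice_eq_zero E₀ m (classData K) 1 (fun E h₀ => by
    haveI := E.numberField
    haveI := E.isGalois
    exact Literature.NumberTheory.Automorphic.IdeleClassGroup.isZero_H1_res_galoisRep (F := K) (E := E.1)
      (FreePresentation.layerHom E₀ h₀).ker) x

end Instantiated

end Literature.NumberTheory.GaloisCohomology.PoitouTateFinite.PoitouTateShaTwoReadout

end Part9

/-!
## Part 10 — port of `Summits/BirchSwinnertonDyer/Rank1Residual/X11b/GlobalH2FiniteSupport.lean` (1 declarations kept)

# Localisation on `2`-cocycles at a finite place: `loc_v [c] = [c ∘ (res_v × res_v)]`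

Declarations of this Part (verbatim port; each keeps its own docstring and citation): `localization_two_twoCocycleClass`.

Reference keys (see `references.bib` and the declarations' citations): [SerreGaloisCohomology1997].
-/

section Part10

open scoped _root_.Classical

open _root_.CategoryTheory _root_.Field _root_.NumberField _root_.IsDedekindDomain _root_.Topology
open Literature.NumberTheory.EllipticCurves
open Literature.NumberTheory.GaloisRepresentations
open scoped ContRepresentation

universe u

namespace Literature.NumberTheory.GaloisCohomology.PoitouTateFinite.H2Support

section Global

variable {K : Type u} [Field K] [NumberField K]

variable {M : Type u} [AddCommGroup M] [TopologicalSpace M] [DiscreteTopology M]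

/-- **Localisation on `2`-cocycles**: `loc_v [c] = [c ∘ (res_v × res_v)]` at a finite place `v`.
Serre, *Galois Cohomology*, I §2.4. [cite: SerreGaloisCohomology1997, Ch. I §2.4 (functoriality of cohomology in the pair (group, module))] -/
theorem localization_two_twoCocycleClass (ρ : DiscreteGaloisModule K M) (v : HeightOneSpectrum (𝓞 K))
    (c : contTwoCocycles ρ.toTopRep) :
    haveI := absoluteGaloisGroup_compactSpace (Place.Completion (Sum.inr v : Place K))
    haveI := absoluteGaloisGroup_compactSpace (v.adicCompletion K)
    galoisCohomology.localization ρ (Sum.inr v) 2 (twoCocycleClass ρ.toTopRep c) =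
      twoCocycleClass (DiscreteGaloisModule.toTopRep (ρ.toLocal (Sum.inr v)))
        (contTwoCocycles.pullback (absGaloisRestrict K (v.adicCompletion K)) (X := ρ.toTopRep)
          (Y := DiscreteGaloisModule.toTopRep (ρ.toLocal (Sum.inr v)))
          (TopRep.ofHom ⟨ContinuousLinearMap.id ℤ M, fun _ => rfl⟩) c) := by
  haveI := absoluteGaloisGroup_compactSpace (Place.Completion (Sum.inr v : Place K))
  haveI := absoluteGaloisGroup_compactSpace (v.adicCompletion K)
  exact map_twoCocycleClass _ _ _ c

variable (W : WeierstrassCurve K) [W.IsElliptic] (p : ℕ) [Fact p.Prime] (k : ℕ)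

end Global

end Literature.NumberTheory.GaloisCohomology.PoitouTateFinite.H2Support

end Part10

/-!
## Part 11 — port of `Summits/BirchSwinnertonDyer/Rank1Residual/X11b/WeakLeopoldt.lean` (1 declarations kept)

# Naturality of localisation in degree `2` at a finite place

Declarations of this Part (verbatim port; each keeps its own docstring and citation): `localization_inr_map_two`.

Reference keys (see `references.bib` and the declarations' citations): [SerreGaloisCohomology1997].
-/

section Part11

open scoped _root_.Classical

open _root_.CategoryTheory _root_.Field _root_.NumberField _root_.IsDedekindDomain
open Literature.NumberTheory.EllipticCurves
open Literature.NumberTheory.GaloisRepresentations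
open Literature.NumberTheory.GaloisRepresentations.DiscreteGaloisModule
open Literature.NumberTheory.GaloisCohomology
open scoped ContRepresentation

namespace Literature.NumberTheory.GaloisCohomology.PoitouTateFinite.WeakLeopoldt

section Generic

variable {K : Type} [Field K] [NumberField K]
  {M M' : Type} [AddCommGroup M] [TopologicalSpace M] [DiscreteTopology M]
  [AddCommGroup M'] [TopologicalSpace M'] [DiscreteTopology M']
  {ρ : DiscreteGaloisModule K M} {ρ' : DiscreteGaloisModule K M'}

/-- **Naturality of localisation in degree `2` at a finite place**:
`loc_v (H²(f) c) = H²(f|_{Γ_{K_v}}) (loc_v c)` (both are the class of `f ∘ c ∘ (res × res)`).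
[cite: SerreGaloisCohomology1997, Ch. I §2.4 (functoriality of cohomology in the pair (group, module))] -/
theorem localization_inr_map_two (f : ρ.toContRepresentation →ⁱL ρ'.toContRepresentation)
    (v : HeightOneSpectrum (𝓞 K)) (x : galoisCohomology ρ 2) :
    galoisCohomology.localization ρ' (Sum.inr v) 2 (galoisCohomology.map f 2 x) =
      galoisCohomology.map (f.restrictField (v.adicCompletion K)) 2
        (galoisCohomology.localization ρ (Sum.inr v) 2 x) := by
  haveI := absoluteGaloisGroup_compactSpace (Place.Completion (Sum.inr v : Place K))
  haveI := absoluteGaloisGroup_compactSpace (v.adicCompletion K)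
  obtain ⟨c, rfl⟩ := twoCocycleClass_surjective _ x
  change galoisCohomology.localization ρ' (Sum.inr v) 2
      (cohomologyMap (DiscreteGaloisModule.homOfIntertwining f) 2 (twoCocycleClass _ c)) =
    cohomologyMap (DiscreteGaloisModule.homOfIntertwining (f.restrictField (v.adicCompletion K))) 2
      (galoisCohomology.localization ρ (Sum.inr v) 2 (twoCocycleClass _ c))
  rw [cohomologyMap_twoCocycleClass, H2Support.localization_two_twoCocycleClass,
    H2Support.localization_two_twoCocycleClass]
  refine Eq.trans ?_ (cohomologyMap_twoCocycleClass (DiscreteGaloisModule.homOfIntertwining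
    (f.restrictField (v.adicCompletion K))) _).symm
  exact congrArg (twoCocycleClass _) (Subtype.ext (ContinuousMap.ext fun _ ↦ rfl))

end Generic

end Literature.NumberTheory.GaloisCohomology.PoitouTateFinite.WeakLeopoldt

end Part11

/-!
## Part 12 — port of `Summits/BirchSwinnertonDyer/BirchSwinnertonDyer/Theorems/CumulativeHeegnerLeopoldtRedSplitControlAtThreeShaTwoAssembly.lean` (4 declarations kept)

# Poitou–Tate, degree two: the `Ш²`-readout road PLUGGED with the canonical obstruction map and ASSEMBLED into the named fact `poitouTate_sha_tateDual K` (Milne I Thm. 4.10 (a)) for a totally complex `K`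

Declarations of this Part (verbatim port; each keeps its own docstring and citation): `map_map_eq_self_of_comp_eq_two`, `bijective_of_addEquiv_pairing`, `exists_perfect_of_addEquiv`, `finite_sha_of_isUnramifiedOutside`.

Reference keys (see `references.bib` and the declarations' citations): [MilneADT2006].
-/

section Part12

open _root_.Function _root_.NumberField _root_.IsDedekindDomain _root_.CategoryTheory CategoryTheory.Abelian
open scoped _root_.NumberField ContRepresentation

set_option autoImplicit false

namespace Literature.NumberTheory.GaloisCohomology.PoitouTateFinite.PoitouTateShaTwoReadout

open _root_.Field
open Literature.NumberTheory.GaloisRepresentations Literature.NumberTheory.GaloisCohomology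
open Literature.NumberTheory.GaloisRepresentations.DiscreteGaloisModule (TateDual tateDual localTatePairingZMod unramifiedSubgroup sha SelmerStructure mem_sha_iff)
open Literature.Algebra.Homology Literature.Algebra.Homology.DiscreteRep Literature.Algebra.Homology.ExtPresentation
open Literature.NumberTheory.GaloisRepresentations.IdeleClassBar (classBarD)
open Literature.AnabelianGeometry.AbsoluteAnabelian.Prop121vii (zmodToQmodZ)
open Literature.NumberTheory.GaloisRepresentations.FreePresentation (presentationComplex presentationComplex_shortExact)
open Literature.NumberTheory.GaloisRepresentations.HomDual (IdeleProjection readout)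
open Literature.NumberTheory.GaloisCohomology.PoitouTateFinite.PoitouTateReduction
  (exists_bidual_intertwining)

section Transport

variable {K : Type} [Field K] [NumberField K]
  {M₁ M₂ : Type} [AddCommGroup M₁] [TopologicalSpace M₁] [DiscreteTopology M₁]
  [AddCommGroup M₂] [TopologicalSpace M₂] [DiscreteTopology M₂]
  {ρ₁ : DiscreteGaloisModule K M₁} {ρ₂ : DiscreteGaloisModule K M₂}

omit [NumberField K] in
/-- **`H²(g) (H²(f) x) = x` when `g ∘ f = id` pointwise** (functoriality of `H²` on explicit `2`-cocycles).
[cite: MilneADT2006, Ch. I §0] -/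
theorem map_map_eq_self_of_comp_eq_two (f : ρ₁.toContRepresentation →ⁱL ρ₂.toContRepresentation)
    (g : ρ₂.toContRepresentation →ⁱL ρ₁.toContRepresentation) (hcomp : ∀ a : M₁, g (f a) = a)
    (x : galoisCohomology ρ₁ 2) : galoisCohomology.map g 2 (galoisCohomology.map f 2 x) = x := by
  haveI := absoluteGaloisGroup_compactSpace K
  obtain ⟨c, rfl⟩ := twoCocycleClass_surjective _ x
  change cohomologyMap (DiscreteGaloisModule.homOfIntertwining g) 2
      (cohomologyMap (DiscreteGaloisModule.homOfIntertwining f) 2 (twoCocycleClass _ c)) = _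
  rw [cohomologyMap_twoCocycleClass, cohomologyMap_twoCocycleClass]
  exact congrArg (twoCocycleClass _) (Subtype.ext (ContinuousMap.ext fun p => hcomp _))

/-- Bijectivity of an adjoint is carried along additive equivalences on both sides. [cite: MilneADT2006, Ch. I §0] -/
theorem bijective_of_addEquiv_pairing {C C' D D' Z : Type*} [AddCommGroup C] [AddCommGroup C'] [AddCommGroup D]
    [AddCommGroup D'] [AddCommGroup Z] (eC : C' ≃+ C) (eD : D' ≃+ D) (p : C →+ D →+ Z) (p' : C' →+ D' →+ Z)
    (hp' : ∀ c' d', p' c' d' = p (eC c') (eD d')) (hp : Function.Bijective p) : Function.Bijective p' := by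
  constructor
  · intro c₁ c₂ h
    apply eC.injective
    apply hp.1
    ext d
    obtain ⟨d', rfl⟩ := eD.surjective d
    rw [← hp', ← hp', h]
  · intro φ
    obtain ⟨c, hc⟩ := hp.2 (φ.comp eD.symm.toAddMonoidHom)
    refine ⟨eC.symm c, ?_⟩
    ext d'
    rw [hp', eC.apply_symm_apply, hc, AddMonoidHom.comp_apply]
    change φ (eD.symm (eD d')) = φ d'
    rw [eD.symm_apply_apply]

/-- **A perfect pairing is carried along additive equivalences**: from `b : A →+ B →+ Z` with both adjoints bijective and
`eA : A' ≃ A`, `eB : B' ≃ B`, the pairing `b'(a', y') = b(eA a', eB y')` has both adjoints bijective. [cite: MilneADT2006, Ch. I §0] -/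
theorem exists_perfect_of_addEquiv {A A' B B' Z : Type*} [AddCommGroup A] [AddCommGroup A'] [AddCommGroup B]
    [AddCommGroup B'] [AddCommGroup Z] (eA : A' ≃+ A) (eB : B' ≃+ B) (b : A →+ B →+ Z)
    (hb : Function.Bijective b) (hbflip : Function.Bijective b.flip) :
    ∃ b' : A' →+ B' →+ Z, (∀ a' y', b' a' y' = b (eA a') (eB y')) ∧ Function.Bijective b' ∧ Function.Bijective b'.flip := by
  let b' : A' →+ B' →+ Z :=
    { toFun := fun a' => (b (eA a')).comp eB.toAddMonoidHom
      map_zero' := by rw [map_zero, map_zero, AddMonoidHom.zero_comp]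
      map_add' := fun a₁ a₂ => by rw [map_add, map_add, AddMonoidHom.add_comp] }
  have hb' : ∀ a' y', b' a' y' = b (eA a') (eB y') := fun _ _ => rfl
  refine ⟨b', hb', bijective_of_addEquiv_pairing eA eB b b' hb' hb,
    bijective_of_addEquiv_pairing eB eA b.flip b'.flip (fun y' a' => ?_) hbflip⟩
  rw [AddMonoidHom.flip_apply, AddMonoidHom.flip_apply, hb']

/-- **`Ш¹(K, M)` is finite** for a finite Galois module unramified outside a finite set of places `S₀ ⊇ {v ∣ ∞}`
(Milne I Lemma 4.8: `Ш¹ ≤` the Selmer group of the structure "strict on `S₀`, unramified off `S₀`", finite by the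
tree's `SelmerFinite.finite_selmerGroup_of_isUnramifiedOutside`). [cite: MilneADT2006, Ch. I, Lemma 4.8] -/
theorem finite_sha_of_isUnramifiedOutside [Finite M₁] (ρ : DiscreteGaloisModule K M₁) (S₀ : Finset (Place K))
    (hinf : ∀ w : InfinitePlace K, (Sum.inl w : Place K) ∈ S₀)
    (hS₀ : ∀ v : HeightOneSpectrum (𝓞 K), (Sum.inr v : Place K) ∉ S₀ → GaloisRep.IsUnramifiedAt v ρ) :
    Finite (sha ρ) := by
  classical
  let 𝓢 : SelmerStructure ρ := SelmerStructure.ofFinite ρ fun v =>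
    if (Sum.inr v : Place K) ∈ S₀ then ⊥ else unramifiedSubgroup (GaloisRep.toLocal v ρ) 1
  have h𝓢 : 𝓢.IsUnramifiedOutside S₀ := ⟨hinf, fun v hv => by
    simp only [𝓢, SelmerStructure.ofFinite_inr, if_neg hv]⟩
  haveI : Finite 𝓢.selmerGroup :=
    Literature.NumberTheory.GaloisCohomology.PoitouTateFinite.GaloisImage.SelmerFinite.finite_selmerGroup_of_isUnramifiedOutside
      ρ hS₀ h𝓢
  exact Finite.of_injective (AddSubgroup.inclusion (DiscreteGaloisModule.sha_le_selmerGroup ρ 𝓢))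
    (AddSubgroup.inclusion_injective _)

end Transport

end Literature.NumberTheory.GaloisCohomology.PoitouTateFinite.PoitouTateShaTwoReadout

end Part12

/-!
## Part 13 — port of `Summits/BirchSwinnertonDyer/BirchSwinnertonDyer/Theorems/ThetaPartnerAtTwoSignedControlAtTwoMuRealUnramifiedAE.lean` (3 declarations kept)

# A finite discrete Galois module is unramified outside a finite set of places (Serre, *Abelian ℓ-adic representations*, I §2.1) — the `S₀` every `∀`-module Poitou–Tate clause needs

Declarations of this Part (verbatim port; each keeps its own docstring and citation): `isUnramifiedAE_of_isOpen_setOf_apply_eq_one`, `isUnramifiedAE_of_finite`, `exists_finset_place_isUnramifiedAt`.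

Reference keys (see `references.bib` and the declarations' citations): [SerreAbelianLadic1968], [MilneADT2006].
-/

section Part13

open _root_.Function _root_.NumberField _root_.IsDedekindDomain _root_.Field _root_.IntermediateField
open scoped _root_.NumberField _root_.Pointwise

universe u

set_option autoImplicit false

namespace Literature.NumberTheory.GaloisCohomology.PoitouTateFinite.SignedEC.MuReal

open Literature.NumberTheory.GaloisRepresentations Literature.NumberTheory

/-! ## Galois representations with open kernel; finite discrete modules -/

section Representations

variable {K : Type u} [Field K] [NumberField K] {A : Type*} [CommRing A] [TopologicalSpace A]
  {M : Type*} [AddCommGroup M] [Module A M] [TopologicalSpace M]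

/-- **A Galois representation whose kernel `{g | ρ g = 1}` is open is unramified almost everywhere** (Serre I §2.1):
apply `eventually_inertia_le_of_isOpen` to the kernel. [cite: SerreAbelianLadic1968, Ch. I §2.1] -/
theorem isUnramifiedAE_of_isOpen_setOf_apply_eq_one (ρ : GaloisRep K A M)
    (hopen : IsOpen {g : absoluteGaloisGroup K | ρ g = 1}) : ρ.IsUnramifiedAE := by
  have hker : ({g : absoluteGaloisGroup K | ρ g = 1} : Set (absoluteGaloisGroup K)) = (ρ.ker : Set _) := by
    ext g
    rw [Set.mem_setOf_eq, SetLike.mem_coe, ContinuousRep.mem_ker, Module.End.one_eq_id]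
  haveI : ρ.ker.Normal := MonoidHom.normal_ker _
  have hev := Literature.NumberTheory.EllipticCurves.eventually_forall_inertia_le (F := K) ρ.ker (hker ▸ hopen)
  rw [Filter.eventually_cofinite] at hev
  refine ⟨_, hev, fun v hv => ?_⟩
  simp only [Set.mem_setOf_eq, not_not] at hv
  intro 𝔓 h𝔓 σ hσ
  have hmem : σ ∈ ρ.ker := hv 𝔓 h𝔓 hσ
  rw [ContinuousRep.mem_ker] at hmem
  exact hmem.trans Module.End.one_eq_id.symm

end Representations

section Discrete

variable {K : Type u} [Field K] [NumberField K] {M : Type u} [AddCommGroup M] [TopologicalSpace M]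
  [DiscreteTopology M]

/-- **Every finite discrete `Γ_K`-module is unramified almost everywhere** (its kernel is open:
`SelmerFinite.isOpen_setOf_apply_eq_one`). [cite: SerreAbelianLadic1968, Ch. I §2.1] -/
theorem isUnramifiedAE_of_finite [Finite M] (ρ : DiscreteGaloisModule K M) : GaloisRep.IsUnramifiedAE ρ :=
  isUnramifiedAE_of_isOpen_setOf_apply_eq_one ρ
    (Literature.NumberTheory.GaloisCohomology.PoitouTateFinite.GaloisImage.SelmerFinite.isOpen_setOf_apply_eq_one ρ)

/-- **The finite set `S₀` of the Poitou–Tate files**: for a finite discrete `Γ_K`-module `M` and `n ≥ 1` there is a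
finite set of places `S₀` containing every infinite place such that, at every finite place `v ∉ S₀`, `v ∤ n` and `M`
is unramified at `v` (the hypothesis `hS₀` of `PoitouTateShaAnnihilator.*`, `…MuRealShaDual*`, and the `S` of Milne I
Thm. 4.10). [cite: SerreAbelianLadic1968, Ch. I §2.1] [cite: MilneADT2006, Ch. I §4, Thm. 4.10] -/
theorem exists_finset_place_isUnramifiedAt [Finite M] (ρ : DiscreteGaloisModule K M) (n : ℕ) [NeZero n] :
    ∃ S₀ : Finset (Place K), (∀ w : InfinitePlace K, (Sum.inl w : Place K) ∈ S₀) ∧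
      ∀ v : HeightOneSpectrum (𝓞 K), (Sum.inr v : Place K) ∉ S₀ →
        ((n : ℕ) : 𝓞 K) ∉ v.asIdeal ∧ GaloisRep.IsUnramifiedAt v ρ := by
  classical
  obtain ⟨S, hSfin, hS⟩ := isUnramifiedAE_of_finite ρ
  -- the finitely many places dividing `n`
  have hn0 : (Ideal.span {((n : ℕ) : 𝓞 K)} : Ideal (𝓞 K)) ≠ ⊥ := by
    rw [Ne, Ideal.span_singleton_eq_bot]
    exact_mod_cast NeZero.ne n
  have hTfin : {v : HeightOneSpectrum (𝓞 K) | ((n : ℕ) : 𝓞 K) ∈ v.asIdeal}.Finite := by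
    refine (Ideal.finite_factors hn0).subset fun v hv => ?_
    simp only [Set.mem_setOf_eq] at hv ⊢
    rw [Ideal.dvd_span_singleton]
    exact hv
  refine ⟨(Finset.univ : Finset (InfinitePlace K)).map ⟨Sum.inl, Sum.inl_injective⟩ ∪
      (hSfin.union hTfin).toFinset.map ⟨Sum.inr, Sum.inr_injective⟩, fun w => ?_, fun v hv => ?_⟩
  · exact Finset.mem_union_left _ (Finset.mem_map.2 ⟨w, Finset.mem_univ w, rfl⟩)
  · have hv' : v ∉ S ∪ {v : HeightOneSpectrum (𝓞 K) | ((n : ℕ) : 𝓞 K) ∈ v.asIdeal} := fun h =>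
      hv (Finset.mem_union_right _ (Finset.mem_map.2 ⟨v, (Set.Finite.mem_toFinset _).2 h, rfl⟩))
    exact ⟨fun h => hv' (Or.inr h), hS v fun h => hv' (Or.inl h)⟩

end Discrete

end Literature.NumberTheory.GaloisCohomology.PoitouTateFinite.SignedEC.MuReal

end Part13

/-!
## Part 14 — port of `Summits/BirchSwinnertonDyer/BirchSwinnertonDyer/Theorems/CumulativeHeegnerLeopoldtRedSplitControlAtThreeShaTwoBHN.lean` (3 declarations kept)

# hypothesis (A) of the Poitou–Tate road discharged by Brauer–Hasse–Noether over `K(M)`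

Declarations of this Part (verbatim port; each keeps its own docstring and citation): `map_tower_two_eq_zero_of_localization_eq_zero`, `units_kummerInclAddHom`, `unitsTransferAddHom_bijective`.

Reference keys (see `references.bib` and the declarations' citations): [SerreLocalFields1979], [MilneADT2006].
-/

section Part14

open _root_.Function _root_.NumberField _root_.IsDedekindDomain _root_.CategoryTheory
open scoped _root_.NumberField ContRepresentation

namespace Literature.NumberTheory.GaloisCohomology.PoitouTateFinite.PoitouTateShaTwoReadout

open _root_.Field
open _root_.TopRep _root_.ContinuousCohomology
open Literature.NumberTheory.GaloisRepresentations Literature.NumberTheory.GaloisCohomology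
open Literature.NumberTheory.GaloisRepresentations.DiscreteGaloisModule (TateDual tateDual units UnitsCarrier MuCarrier mu unramifiedSubgroup localTatePairingZMod)
open Literature.NumberTheory.EllipticCurves (closureEmb resGal resGalOfEmb exists_algHom_eq_comp resGalOfEmb_comp
  resGalOfEmb_comp_tower adicCompletionMap adicCompletionMap_coe)

section Ascend

variable {K : Type} [Field K] [NumberField K]
variable {V : Type} [AddCommGroup V] [TopologicalSpace V] [DiscreteTopology V] (X : DiscreteGaloisModule K V)

/-- **Local triviality ascends `L/K` in degree 2.**  For a finite place `w` of `L` above `v = w ∩ 𝓞_K`, a class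
`c ∈ H²(K, X)` with `loc_v c = 0` and ANY morphism of coefficients `F : X|_{Γ_{L_w}} → Y` along the composite
`Γ_{L_w} → Γ_L → Γ_K`: `H²(Γ_{L_w} → Γ_L → Γ_K, F)(c) = 0`.  The composite is conjugate (by one `g ∈ Γ_K`, from the
two `K`-embeddings `K̄ → \bar{L_w}`) to `Γ_{L_w} → Γ_{K_v} → Γ_K`, inner automorphisms act trivially on `H²`, and the
second route factors through `loc_v c = 0`. [cite: SerreLocalFields1979, VII §5 Prop. 3][cite: MilneADT2006, I §4] -/
theorem map_tower_two_eq_zero_of_localization_eq_zero (L : Type) [Field L] [NumberField L] [Algebra K L]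
    (w : HeightOneSpectrum (𝓞 L)) {W : Type} [AddCommGroup W] [TopologicalSpace W] [DiscreteTopology W]
    (Y : DiscreteGaloisModule (w.adicCompletion L) W)
    (F : TopRep.res (((absGaloisRestrict K L).comp (absGaloisRestrict L (w.adicCompletion L)) :
        absoluteGaloisGroup (w.adicCompletion L) →ₜ* absoluteGaloisGroup K) :
        absoluteGaloisGroup (w.adicCompletion L) →* absoluteGaloisGroup K) X.toTopRep ⟶ Y.toTopRep)
    (c : galoisCohomology X 2)
    (hc : galoisCohomology.localization X (Sum.inr (w.under (𝓞 K))) 2 c = 0) :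
    ContinuousCohomology.map ((absGaloisRestrict K L).comp (absGaloisRestrict L (w.adicCompletion L))) F 2 c = 0 := by
  set v : HeightOneSpectrum (𝓞 K) := w.under (𝓞 K) with hv
  haveI := absoluteGaloisGroup_compactSpace K
  haveI := absoluteGaloisGroup_compactSpace (w.adicCompletion L)
  haveI := absoluteGaloisGroup_compactSpace (v.adicCompletion K)
  -- the tower `K → K_v → L_w`
  haveI : w.asIdeal.LiesOver v.asIdeal := ⟨rfl⟩
  letI : Algebra (v.adicCompletion K) (w.adicCompletion L) := (adicCompletionMap (K := K) L v w).toAlgebra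
  haveI : IsScalarTower K (v.adicCompletion K) (w.adicCompletion L) :=
    IsScalarTower.of_algebraMap_eq fun x ↦ (adicCompletionMap_coe (K := K) L v w x).symm
  -- the two embeddings `K̄ → \bar{L_w}` and the conjugating element
  let ιL : AlgebraicClosure K →ₐ[K] AlgebraicClosure L := closureEmb (K := K) L
  let ι₃ : AlgebraicClosure L →ₐ[L] AlgebraicClosure (w.adicCompletion L) := closureEmb (K := L) (w.adicCompletion L)
  let ιv : AlgebraicClosure K →ₐ[K] AlgebraicClosure (v.adicCompletion K) := closureEmb (K := K) (v.adicCompletion K)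
  let ι₂ : AlgebraicClosure (v.adicCompletion K) →ₐ[v.adicCompletion K] AlgebraicClosure (w.adicCompletion L) :=
    closureEmb (K := v.adicCompletion K) (w.adicCompletion L)
  obtain ⟨g₀, hg⟩ := exists_algHom_eq_comp ((ι₂.restrictScalars K).comp ιv) ((ι₃.restrictScalars K).comp ιL)
  let g : absoluteGaloisGroup K := g₀
  let θA : absoluteGaloisGroup (w.adicCompletion L) →ₜ* absoluteGaloisGroup K :=
    (absGaloisRestrict K L).comp (absGaloisRestrict L (w.adicCompletion L))
  let θB : absoluteGaloisGroup (w.adicCompletion L) →ₜ* absoluteGaloisGroup K :=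
    (absGaloisRestrict K (v.adicCompletion K)).comp (absGaloisRestrict (v.adicCompletion K) (w.adicCompletion L))
  have key : ∀ τ, θA τ = g⁻¹ * θB τ * g := fun τ ↦ by
    change resGal (K := K) L (resGal (K := L) (w.adicCompletion L) τ) =
      g⁻¹ * resGal (K := K) (v.adicCompletion K) (resGal (K := v.adicCompletion K) (w.adicCompletion L) τ) * g
    have h1 : resGal (K := K) L (resGal (K := L) (w.adicCompletion L) τ) =
        resGalOfEmb ((ι₃.restrictScalars K).comp ιL) τ := by
      rw [resGalOfEmb_comp_tower ιL ι₃]; rfl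
    have h2 : resGal (K := K) (v.adicCompletion K) (resGal (K := v.adicCompletion K) (w.adicCompletion L) τ) =
        resGalOfEmb ((ι₂.restrictScalars K).comp ιv) τ := by
      rw [resGalOfEmb_comp_tower ιv ι₂]; rfl
    rw [h1, h2, hg, resGalOfEmb_comp]
    rfl
  -- `F ∘ g⁻¹` is equivariant along the second route
  have hcomm : ∀ (τ : absoluteGaloisGroup (w.adicCompletion L)) (x : V),
      F.hom (X g⁻¹ (X (θB τ) x)) = Y τ (F.hom (X g⁻¹ x)) := fun τ x ↦ by
    have hx : X g⁻¹ (X (θB τ) x) = X (θA τ) (X g⁻¹ x) := by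
      rw [← Module.End.mul_apply, ← map_mul, ← Module.End.mul_apply, ← map_mul, key]
      congr 2
      group
    rw [hx]
    exact TopRep.hom_comm_apply F τ (X g⁻¹ x)
  let ginv : V →L[ℤ] V := { toLinearMap := X g⁻¹, cont := continuous_of_discreteTopology }
  let f₂ : TopRep.res (θB : absoluteGaloisGroup (w.adicCompletion L) →* absoluteGaloisGroup K) X.toTopRep ⟶
      Y.toTopRep :=
    TopRep.ofHom ⟨F.hom.toContinuousLinearMap.comp ginv, fun τ => by
      refine ContinuousLinearMap.ext fun x => ?_
      change F.hom (X g⁻¹ (X (θB τ) x)) = Y τ (F.hom (X g⁻¹ x))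
      exact hcomm τ x⟩
  have hinner : ContinuousCohomology.map θA F 2 c = ContinuousCohomology.map θB f₂ 2 c :=
    map_eq_map_of_inner_two g θB θA key F f₂ (fun x => by
      change F.hom x = F.hom (X g⁻¹ (X g x))
      rw [← Module.End.mul_apply, ← map_mul, inv_mul_cancel, map_one, Module.End.one_apply]) c
  -- the second route factors through `loc_v c = 0`
  let f₂' : TopRep.res (absGaloisRestrict (v.adicCompletion K) (w.adicCompletion L) :
      absoluteGaloisGroup (w.adicCompletion L) →* absoluteGaloisGroup (v.adicCompletion K))
        (X.restrictField (v.adicCompletion K)).toTopRep ⟶ Y.toTopRep :=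
    TopRep.ofHom ⟨F.hom.toContinuousLinearMap.comp ginv, fun τ => by
      refine ContinuousLinearMap.ext fun x => ?_
      change F.hom (X g⁻¹ (X (θB τ) x)) = Y τ (F.hom (X g⁻¹ x))
      exact hcomm τ x⟩
  have hc' : ContinuousCohomology.map (absGaloisRestrict K (v.adicCompletion K))
      (TopRep.ofHom ⟨ContinuousLinearMap.id ℤ V, fun _ => rfl⟩ :
        TopRep.res (absGaloisRestrict K (v.adicCompletion K) : _ →* absoluteGaloisGroup K) X.toTopRep ⟶
          (X.restrictField (v.adicCompletion K)).toTopRep) 2 c = 0 := hc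
  change ContinuousCohomology.map θA F 2 c = 0
  rw [hinner, map_comp_apply_of (absGaloisRestrict K (v.adicCompletion K))
    (absGaloisRestrict (v.adicCompletion K) (w.adicCompletion L)) θB (fun _ => rfl)
    (TopRep.ofHom ⟨ContinuousLinearMap.id ℤ V, fun _ => rfl⟩) f₂' f₂ (fun _ => rfl) 2 c, hc']
  exact map_zero _

end Ascend

section Transport

variable {K : Type} [Field K] [NumberField K]
variable {M : Type} [AddCommGroup M] [TopologicalSpace M] [DiscreteTopology M] [Finite M]
variable (ρ : DiscreteGaloisModule K M) (n : ℕ) (hM : ∀ m : M, n • m = 0)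

open Literature.NumberTheory.GaloisRepresentations.HomDual (unitsTransferAddHom unitsTransferAddHom_smul unitsVal_unitsTransferAddHom)
open Literature.NumberTheory.GaloisRepresentations.FreePresentation (presentationLayer)
open LocalWeilDatum (galFixing)

omit [NumberField K] in
/-- `μ_n ↪ K̄ˣ` is `Γ_K`-equivariant (on carriers). [cite: SerreLocalFields1979, X §3] -/
theorem units_kummerInclAddHom (g : absoluteGaloisGroup K) (ζ : MuCarrier K n) :
    units K g (kummerInclAddHom K n ζ) = kummerInclAddHom K n (mu K n g ζ) :=
  (TopRep.hom_comm_apply (kummerι K n) g ζ).symm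

omit [NumberField K] in
/-- `u ↦ ι u : K̄ˣ → \bar{K′}ˣ` is bijective for `K′/K` algebraic (the chosen `ι : K̄ → \bar{K′}` is then an isomorphism).
[cite: MilneADT2006, I §0] -/
theorem unitsTransferAddHom_bijective (K' : Type) [Field K'] [Algebra K K'] [Algebra.IsAlgebraic K K'] :
    Function.Bijective (unitsTransferAddHom K K') := by
  have hι := absClosureEmbedding_bijective K K'
  refine ⟨fun u₁ u₂ h => ?_, fun u' => ?_⟩
  · apply unitsVal_injective K
    have h' := congrArg (fun u => ((unitsVal K' u : (AlgebraicClosure K')ˣ) : AlgebraicClosure K')) h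
    simp only [unitsVal_unitsTransferAddHom, Units.coe_map, MonoidHom.coe_coe] at h'
    exact Units.ext (hι.1 h')
  · obtain ⟨x, hx⟩ := hι.2 ((unitsVal K' u' : (AlgebraicClosure K')ˣ) : AlgebraicClosure K')
    have hx0 : x ≠ 0 := by
      rintro rfl
      rw [map_zero] at hx
      exact (unitsVal K' u').ne_zero hx.symm
    refine ⟨UnitsCarrier.ofUnits (Units.mk0 x hx0), unitsVal_injective K' (Units.ext ?_)⟩
    rw [unitsVal_unitsTransferAddHom, unitsVal_ofUnits, Units.coe_map, MonoidHom.coe_coe]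
    exact hx

end Transport

end Literature.NumberTheory.GaloisCohomology.PoitouTateFinite.PoitouTateShaTwoReadout

end Part14

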